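import Literature.MathematicalPhysics.QuantumManyBody.PeriodicBoseGasEq243
import Literature.MathematicalPhysics.QuantumManyBody.PeriodicBoseGasEq317
import Mathlib.MeasureTheory.Group.LIntegral
import HarnessLib

/-!
# Fournais 2020, §2: the calculus of the projections `Pᵢ`, `Qᵢ` on `L²(Λⁿ)` (proofs)

Topic `Literature/MathematicalPhysics/QuantumManyBody`, sibling of `PeriodicBoseGasSectorOps.lean`
(provefact `Literature.MathematicalPhysics.QuantumManyBody.BoseGas.Fournais2020_condensation`). The named fact `Fournais2020_eq225`
([Fournais2020, (2.25)] = Lemma 2.3 = [FournaisSolovej2020, Lemma B.2]), one of the two remaining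
inputs of `Fournais2020_condensation_of_scattering_eq225_lemma24` (`PeriodicBoseGasReduction.lean`),
is an inequality between expectations in an `n`-body function `Φ` on the box `Λ(u)ⁿ` involving
the projections `P = ℓ⁻³|1⟩⟨1|`, `Q = 1 - P` (2.5) on the `i`-th particle (`nbodyP`, `nbodyQ`,
`PeriodicBoseGasSectorOps.lean`). Its proof (`PeriodicBoseGasEq225.lean`) is first-quantised
bookkeeping with these projections; this file supplies their calculus as functions on `Λⁿ⁺¹`
with the product measure `dX|_{Λⁿ⁺¹}`, without any operator theory:

* **Transport.** `Λ(u)ⁿ⁺¹ ≅ Λ(u) × Λ(u)ⁿ` at the coordinate `i` (Mathlib's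
  `MeasurableEquiv.piFinSuccAbove`, measure preserving for the restricted volumes,
  `volume_restrict_boxConfig`), whence Tonelli/Fubini in the form "integrate out `xᵢ`":
  `∫(∫_Λ G(X; xᵢ = y)dy)dX = |Λ|∫G` (`lintegral_lintegral_update`, `integral_integral_update`).
* **`Pᵢ`.** Measurability; `|PᵢF|² ≤ ℓ⁻³∫_Λ|F(X;xᵢ=y)|²dy` (Cauchy–Schwarz) and the contractions
  `‖PᵢF‖₂ ≤ ‖F‖₂`, `‖PᵢF‖₁ ≤ ‖F‖₁`; additivity a.e. (slices of `L¹` functions are a.e.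
  integrable); `∫PᵢK = ∫K` (`integral_nbodyP`: `Pᵢ` is the conditional expectation onto the
  functions of the other particles) and hence `⟨H, PᵢG⟩ = ⟨H, G⟩` for `H` not depending on `xᵢ`
  (`integral_conj_mul_nbodyP`); `PᵢPⱼ = PⱼPᵢ` a.e. (Fubini on `Λ × Λ`, `nbodyP_comm_ae`).
* **`L²`.** Orthogonality `⟨PᵢF, QᵢF⟩ = 0`, Pythagoras `‖F‖² = ‖PᵢF‖² + ‖QᵢF‖²`,
  `⟨F, QᵢF⟩ = ‖QᵢF‖²`, `Qᵢ(PⱼF) = Pⱼ(QᵢF)` a.e. and `‖Qᵢ(PⱼF)‖ ≤ ‖QᵢF‖`; the identification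
  `⟨Φ, n₊Φ⟩ = ∑ᵢ‖QᵢΦ‖²` of `nPlusBoxN` (`PeriodicBoseGasSector.lean`, written with the one-body
  `Q_u` on slices) (`nPlusBoxN_eq_sum_lintegral`).
* **Weights.** "`PᵢF(xᵢ,y)Pᵢ = ℓ⁻³Pᵢ∫F(x,y)dx`" ([Fournais2020, remark preceding Lemma 2.3]): a weight in `xᵢ` (or in
  `(xᵢ,xⱼ)`) against a function not depending on `xᵢ` integrates to its `xᵢ`-marginal
  (`lintegral_weight_mul`, `lintegral_pairWeight_mul`), with the bound by `sup_x∫_Λω(y,x)dy`;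
  the signed version `∫ω(xᵢ,xⱼ)conj(H)PᵢG = ℓ⁻³∫(∫_Λω(y,xⱼ)dy)conj(H)G`
  (`integral_pairWeight_conj_mul_nbodyP`), the workhorse of the one-`Q` terms of (2.22).
* **Potentials.** `w₁ = w(1-ω)` (2.8), symmetry, `W ≤ 2v` and `∫w(x,y)dy ≤ 2‖χ‖²_∞∫v` for `R/ℓ`
  small, and the double integrals (2.10): `∬w₁(x,y)h(x-y) = ℓ³∫gh` (`g = v(1-ω)`), in particular
  `∬w₁ = 8πaℓ³` and `∬w₂ = ∬w₁(1+ω) = ℓ³(8πa + ∫gω)` (`lintegral_lintegral_pairLoc₁`, `…₂`).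
* **Conversion** between the real weights `W.toReal` of the Bochner integrals in which (2.25) is
  stated (`a2Form`) and the `ℝ≥0∞` forms of `PeriodicBoseGasBox.lean`; finite double sums over
  ordered pairs `i ≠ j`.

No new definitions.

## References

* [Fournais2020] S. Fournais, *Length scales for BEC in the dilute Bose gas*, arXiv:2011.00309,
  EMS Ser. Congr. Rep. 18 (2021), doi:10.4171/ecr/18-1/7: (2.5), (2.8)–(2.10), (2.15), the remark preceding Lemma 2.3 (arXiv v2 p. 8),
  Lemma 2.3 (2.22)–(2.25).
* [FournaisSolovej2020] S. Fournais, J. P. Solovej, *The energy of dilute Bose gases*,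
  Ann. of Math. 192 (2020) 893–976: Lemma B.2.
-/

noncomputable section

open MeasureTheory
open scoped ENNReal NNReal ComplexConjugate

namespace Literature.MathematicalPhysics.QuantumManyBody.BoseGas

variable {n : ℕ} {ℓ : ℝ} {u : Space}

/-! ### The box measure `dX` on `Λ(u)ⁿ` and the splitting `Λⁿ⁺¹ ≅ Λ × Λⁿ` at a coordinate -/

section Transport

/-- `Λ(u)ⁿ` is a product set, so `dX|_{Λⁿ}` is the product of the `dx|_Λ`. [folklore] -/
theorem volume_restrict_boxConfig (n : ℕ) (ℓ : ℝ) (u : Space) :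
    (volume : Measure (Config n)).restrict (boxConfig n ℓ u) =
      Measure.pi fun _ : Fin n => (volume : Measure Space).restrict (slidingBox ℓ u) := by
  rw [boxConfig_eq_pi, volume_pi, Measure.restrict_pi_pi]

/-- `|Λ(u)|` as the total mass of `dx|_Λ`. [cite: Fournais2020, (3.4)] -/
theorem volume_restrict_slidingBox_univ (ℓ : ℝ) (u : Space) :
    (volume : Measure Space).restrict (slidingBox ℓ u) Set.univ = ENNReal.ofReal ℓ ^ 3 := by
  rw [Measure.restrict_apply_univ, volume_slidingBox]

/-- `dx|_Λ` is a finite measure. [cite: Fournais2020, (3.4)] -/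
theorem isFiniteMeasure_restrict_slidingBox (ℓ : ℝ) (u : Space) :
    IsFiniteMeasure ((volume : Measure Space).restrict (slidingBox ℓ u)) :=
  ⟨by rw [volume_restrict_slidingBox_univ]; exact ENNReal.pow_lt_top ENNReal.ofReal_lt_top⟩

/-- Splitting off the `i`-th coordinate, `X ↦ (xᵢ, X̂ᵢ)`, carries `dX|_{Λⁿ⁺¹}` to
`dx|_Λ ⊗ dX̂|_{Λⁿ}`. [folklore] -/
theorem measurePreserving_piFinSuccAbove_box (i : Fin (n + 1)) (ℓ : ℝ) (u : Space) :
    MeasurePreserving (MeasurableEquiv.piFinSuccAbove (fun _ => Space) i)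
      ((volume : Measure (Config (n + 1))).restrict (boxConfig (n + 1) ℓ u))
      (((volume : Measure Space).restrict (slidingBox ℓ u)).prod
        ((volume : Measure (Config n)).restrict (boxConfig n ℓ u))) := by
  rw [volume_restrict_boxConfig, volume_restrict_boxConfig]
  exact measurePreserving_piFinSuccAbove (fun _ => (volume : Measure Space).restrict (slidingBox ℓ u)) i

/-- `X[i ↦ y] = insert y at i into X̂ᵢ` (restatement of `Fin.insertNth_removeNth` in the
orientation used below; private, not exported). [folklore] -/
private theorem update_eq_insertNth (i : Fin (n + 1)) (X : Config (n + 1)) (y : Space) :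
    Function.update X i y = i.insertNth y (i.removeNth X) :=
  (Fin.insertNth_removeNth i y X).symm

/-- **Integrating out one coordinate** (Tonelli on `Λⁿ⁺¹ ≅ Λ × Λⁿ`): for `G ≥ 0` measurable,
`∫_{Λⁿ⁺¹} (∫_Λ G(X; xᵢ = y) dy) dX = |Λ| ∫_{Λⁿ⁺¹} G dX`. [folklore] -/
theorem lintegral_lintegral_update (i : Fin (n + 1)) {G : Config (n + 1) → ℝ≥0∞}
    (hG : Measurable G) :
    ∫⁻ X in boxConfig (n + 1) ℓ u, ∫⁻ y in slidingBox ℓ u, G (Function.update X i y) =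
      ENNReal.ofReal ℓ ^ 3 * ∫⁻ X in boxConfig (n + 1) ℓ u, G X := by
  set ν : Measure Space := volume.restrict (slidingBox ℓ u) with hν
  set π' : Measure (Config n) := volume.restrict (boxConfig n ℓ u) with hπ'
  set e := MeasurableEquiv.piFinSuccAbove (fun _ : Fin (n + 1) => Space) i with he_def
  have he := measurePreserving_piFinSuccAbove_box (n := n) i ℓ u
  rw [← hν, ← hπ', ← he_def] at he
  set H : Config n → ℝ≥0∞ := fun X' => ∫⁻ y, G (i.insertNth y X') ∂ν with hH
  have hGe : Measurable fun p : Space × Config n => G (e.symm p) := hG.comp e.symm.measurable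
  have hHm : Measurable H := by
    have : Measurable fun p : Config n × Space => G (e.symm (p.2, p.1)) :=
      hGe.comp (measurable_snd.prodMk measurable_fst)
    exact this.lintegral_prod_right'
  -- the left-hand side is `∫ H(X̂ᵢ) dX`
  have h1 : ∫⁻ X in boxConfig (n + 1) ℓ u, ∫⁻ y in slidingBox ℓ u, G (Function.update X i y) =
      ∫⁻ X in boxConfig (n + 1) ℓ u, H (e X).2 := by
    refine lintegral_congr fun X => ?_
    simp only [hH, update_eq_insertNth]
    rfl
  have h2 : ∫⁻ X in boxConfig (n + 1) ℓ u, H (e X).2 = ∫⁻ p, H p.2 ∂(ν.prod π') := by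
    rw [← he.lintegral_comp_emb e.measurableEmbedding]
  have h3 : ∫⁻ p, H p.2 ∂(ν.prod π') = ν Set.univ * ∫⁻ X', H X' ∂π' := by
    rw [lintegral_prod (fun p : Space × Config n => H p.2) (hHm.comp measurable_snd).aemeasurable]
    simp only [lintegral_const, mul_comm]
  -- the right-hand side is `∫ H dX̂`
  have h4 : ∫⁻ X in boxConfig (n + 1) ℓ u, G X = ∫⁻ X', H X' ∂π' := by
    rw [← he.symm.lintegral_comp_emb e.symm.measurableEmbedding,
      lintegral_prod_symm _ hGe.aemeasurable]
    rfl
  rw [h1, h2, h3, h4, hν, volume_restrict_slidingBox_univ]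

/-- **Integrating out one coordinate**, Bochner form (Fubini): for `K` integrable on `Λⁿ⁺¹`,
`∫_{Λⁿ⁺¹} (∫_Λ K(X; xᵢ = y) dy) dX = |Λ| ∫_{Λⁿ⁺¹} K dX`. [folklore] -/
theorem integral_integral_update (i : Fin (n + 1)) {K : Config (n + 1) → ℂ}
    (hK : Integrable K ((volume : Measure (Config (n + 1))).restrict (boxConfig (n + 1) ℓ u))) :
    ∫ X in boxConfig (n + 1) ℓ u, ∫ y in slidingBox ℓ u, K (Function.update X i y) =
      (ℓ ^ 3 : ℝ) • ∫ X in boxConfig (n + 1) ℓ u, K X := by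
  set ν : Measure Space := volume.restrict (slidingBox ℓ u) with hν
  set π' : Measure (Config n) := volume.restrict (boxConfig n ℓ u) with hπ'
  set e := MeasurableEquiv.piFinSuccAbove (fun _ : Fin (n + 1) => Space) i with he_def
  have he := measurePreserving_piFinSuccAbove_box (n := n) i ℓ u
  rw [← hν, ← hπ', ← he_def] at he
  set H : Config n → ℂ := fun X' => ∫ y, K (i.insertNth y X') ∂ν with hH
  have hKe : Integrable (fun p : Space × Config n => K (e.symm p)) (ν.prod π') :=
    he.symm.integrable_comp_emb e.symm.measurableEmbedding |>.mpr hK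
  -- wrong direction guard
  have h1 : ∫ X in boxConfig (n + 1) ℓ u, ∫ y in slidingBox ℓ u, K (Function.update X i y) =
      ∫ X in boxConfig (n + 1) ℓ u, H (e X).2 := by
    refine integral_congr_ae (Filter.Eventually.of_forall fun X => ?_)
    simp only [hH, update_eq_insertNth]
    rfl
  have h2 : ∫ X in boxConfig (n + 1) ℓ u, H (e X).2 = ∫ p, H p.2 ∂(ν.prod π') := by
    rw [← he.integral_comp' (fun p : Space × Config n => H p.2)]
  have h3 : ∫ p, H p.2 ∂(ν.prod π') = (ν Set.univ).toReal • ∫ X', H X' ∂π' := by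
    rw [integral_fun_snd]; rfl
  have h4 : ∫ X in boxConfig (n + 1) ℓ u, K X = ∫ X', H X' ∂π' := by
    rw [← he.symm.integral_comp' , integral_prod_symm _ hKe]
    rfl
  by_cases hℓ : 0 ≤ ℓ
  · rw [h1, h2, h3, h4, hν, volume_restrict_slidingBox_univ, ← ENNReal.ofReal_pow hℓ,
      ENNReal.toReal_ofReal (pow_nonneg hℓ 3)]
  · -- for `ℓ < 0` the box is empty and both sides vanish
    have hempty : slidingBox ℓ u = ∅ := by
      ext x
      simp only [slidingBox, Set.mem_Icc, Set.mem_setOf_eq, Set.mem_empty_iff_false, iff_false,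
        not_forall, not_and, not_le]
      exact ⟨0, fun h => by linarith⟩
    have hB : boxConfig (n + 1) ℓ u = ∅ := by
      ext X
      simp [boxConfig, hempty]
    simp [hB]

end Transport

/-! ### The projection `Pᵢ`: measurability, contraction, linearity and commutation a.e. -/

section Projection

variable {N : ℕ}

/-- `X ↦ (PᵢF)(X)` is measurable for measurable `F`. [cite: Fournais2020, (2.5)] -/
theorem measurable_nbodyP (ℓ : ℝ) (u : Space) (i : Fin N) {F : Config N → ℂ} (hF : Measurable F) :
    Measurable (nbodyP ℓ u i F) := by
  have hsl : Measurable fun r : Config N × Space => F (Function.update r.1 i r.2) :=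
    hF.comp measurable_update'
  set S : Set (Config N × Space) := {r | r.2 ∈ slidingBox ℓ u} with hSdef
  have hS : MeasurableSet S := measurable_snd (measurableSet_slidingBox ℓ u)
  have hM : StronglyMeasurable fun X : Config N => ∫ y in slidingBox ℓ u, F (Function.update X i y) := by
    have h := (hsl.stronglyMeasurable.indicator hS).integral_prod_right' (ν := (volume : Measure Space))
    have hfun : (fun X : Config N => ∫ y in slidingBox ℓ u, F (Function.update X i y)) =
        fun X => ∫ y, S.indicator (fun r => F (Function.update r.1 i r.2)) (X, y) := by
      funext X
      rw [← integral_indicator (measurableSet_slidingBox ℓ u)]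
      rfl
    rw [hfun]
    exact h
  exact hM.measurable.const_smul ((ℓ ^ 3)⁻¹ : ℝ)

/-- `X ↦ (QᵢF)(X)` is measurable for measurable `F`. [cite: Fournais2020, (2.5)] -/
theorem measurable_nbodyQ (ℓ : ℝ) (u : Space) (i : Fin N) {F : Config N → ℂ} (hF : Measurable F) :
    Measurable (nbodyQ ℓ u i F) :=
  hF.sub (measurable_nbodyP ℓ u i hF)

/-- `QᵢF` does not depend on `xᵢ` in its `Pᵢ`-part: `(QᵢF)(X; xᵢ = y) = F(X; xᵢ = y) - (PᵢF)(X)`.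
[cite: Fournais2020, (2.5)] -/
theorem nbodyQ_update (ℓ : ℝ) (u : Space) (i : Fin N) (F : Config N → ℂ) (X : Config N) (y : Space) :
    nbodyQ ℓ u i F (Function.update X i y) = F (Function.update X i y) - nbodyP ℓ u i F X := by
  rw [nbodyQ, nbodyP_update]

/-- `Pᵢ` is homogeneous for factors not depending on `xᵢ`: `Pᵢ(HG) = H·PᵢG`.
[cite: Fournais2020, (2.5)] -/
theorem nbodyP_mul_left (ℓ : ℝ) (u : Space) (i : Fin N) {H : Config N → ℂ}
    (hH : ∀ X y, H (Function.update X i y) = H X) (G : Config N → ℂ) (X : Config N) :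
    nbodyP ℓ u i (fun Y => H Y * G Y) X = H X * nbodyP ℓ u i G X := by
  simp only [nbodyP, hH, integral_const_mul, mul_smul_comm]

/-- `Pᵢ(cF) = c PᵢF`. [cite: Fournais2020, (2.5)] -/
theorem nbodyP_const_mul (ℓ : ℝ) (u : Space) (i : Fin N) (c : ℂ) (G : Config N → ℂ) (X : Config N) :
    nbodyP ℓ u i (fun Y => c * G Y) X = c * nbodyP ℓ u i G X :=
  nbodyP_mul_left ℓ u i (H := fun _ => c) (fun _ _ => rfl) G X

/-- `Pᵢ(-F) = -PᵢF`. [cite: Fournais2020, (2.5)] -/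
theorem nbodyP_neg (ℓ : ℝ) (u : Space) (i : Fin N) (G : Config N → ℂ) (X : Config N) :
    nbodyP ℓ u i (fun Y => -G Y) X = -nbodyP ℓ u i G X := by
  simp only [nbodyP, integral_neg, smul_neg]

/-- **Cauchy–Schwarz**: `‖∫ f dν‖² ≤ ν(univ) ∫ ‖f‖² dν`. [folklore] -/
theorem enorm_integral_sq_le {α : Type*} [MeasurableSpace α] (ν : Measure α) {f : α → ℂ}
    (hf : AEMeasurable f ν) :
    ‖∫ x, f x ∂ν‖ₑ ^ 2 ≤ ν Set.univ * ∫⁻ x, ‖f x‖ₑ ^ 2 ∂ν := by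
  calc ‖∫ x, f x ∂ν‖ₑ ^ 2 ≤ (∫⁻ x, ‖f x‖ₑ ∂ν) ^ 2 := by
        gcongr
        exact enorm_integral_le_lintegral_enorm _
    _ = (∫⁻ x, 1 * ‖f x‖ₑ ∂ν) ^ 2 := by simp only [one_mul]
    _ ≤ ((∫⁻ x, (1 : ℝ≥0∞) ^ (2 : ℝ) ∂ν) ^ (1 / (2 : ℝ)) *
          (∫⁻ x, ‖f x‖ₑ ^ (2 : ℝ) ∂ν) ^ (1 / (2 : ℝ))) ^ 2 := by
        gcongr
        exact ENNReal.lintegral_mul_le_Lp_mul_Lq ν Real.HolderConjugate.two_two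
          aemeasurable_const hf.enorm
    _ = ν Set.univ * ∫⁻ x, ‖f x‖ₑ ^ 2 ∂ν := by
        rw [mul_pow, ← ENNReal.rpow_natCast, ← ENNReal.rpow_natCast, ← ENNReal.rpow_mul,
          ← ENNReal.rpow_mul]
        norm_num

/-- **`Pᵢ` pointwise**: `|(PᵢF)(X)|² ≤ ℓ⁻³ ∫_Λ |F(X; xᵢ = y)|² dy` (Cauchy–Schwarz on the box).
[cite: Fournais2020, (2.5)] -/
theorem nnnorm_nbodyP_sq_le (hℓ : 0 < ℓ) (u : Space) (i : Fin N) {F : Config N → ℂ}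
    (hF : Measurable F) (X : Config N) :
    (‖nbodyP ℓ u i F X‖₊ : ℝ≥0∞) ^ 2 ≤
      (ENNReal.ofReal ℓ ^ 3)⁻¹ *
        ∫⁻ y in slidingBox ℓ u, (‖F (Function.update X i y)‖₊ : ℝ≥0∞) ^ 2 := by
  have hℓ3 : ENNReal.ofReal ℓ ^ 3 ≠ 0 := pow_ne_zero _ (by rwa [Ne, ENNReal.ofReal_eq_zero, not_le])
  have hℓ3' : ENNReal.ofReal ℓ ^ 3 ≠ ⊤ := ENNReal.pow_ne_top ENNReal.ofReal_ne_top
  have hsl : Measurable fun y => F (Function.update X i y) := hF.comp (measurable_update X)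
  have hc : ((‖((ℓ ^ 3)⁻¹ : ℝ)‖₊ : ℝ≥0) : ℝ≥0∞) = (ENNReal.ofReal ℓ ^ 3)⁻¹ := by
    rw [← enorm_eq_nnnorm, Real.enorm_eq_ofReal (by positivity),
      ENNReal.ofReal_inv_of_pos (by positivity), ENNReal.ofReal_pow hℓ.le]
  have hnorm : ((‖nbodyP ℓ u i F X‖₊ : ℝ≥0) : ℝ≥0∞) =
      (ENNReal.ofReal ℓ ^ 3)⁻¹ * ‖∫ y in slidingBox ℓ u, F (Function.update X i y)‖ₑ := by
    rw [nbodyP, nnnorm_smul, ENNReal.coe_mul, hc, enorm_eq_nnnorm]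
  rw [hnorm, mul_pow]
  calc (ENNReal.ofReal ℓ ^ 3)⁻¹ ^ 2 * ‖∫ y in slidingBox ℓ u, F (Function.update X i y)‖ₑ ^ 2
      ≤ (ENNReal.ofReal ℓ ^ 3)⁻¹ ^ 2 * ((volume.restrict (slidingBox ℓ u)) Set.univ *
          ∫⁻ y in slidingBox ℓ u, ‖F (Function.update X i y)‖ₑ ^ 2) := by
        gcongr
        exact enorm_integral_sq_le _ hsl.aemeasurable
    _ = (ENNReal.ofReal ℓ ^ 3)⁻¹ *
          ∫⁻ y in slidingBox ℓ u, (‖F (Function.update X i y)‖₊ : ℝ≥0∞) ^ 2 := by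
        rw [volume_restrict_slidingBox_univ, ← mul_assoc, sq, mul_assoc _ _ (ENNReal.ofReal ℓ ^ 3),
          ENNReal.inv_mul_cancel hℓ3 hℓ3', mul_one]
        simp only [enorm_eq_nnnorm]

/-- `|(PᵢF)(X)| ≤ ℓ⁻³ ∫_Λ |F(X; xᵢ = y)| dy`. [cite: Fournais2020, (2.5)] -/
theorem nnnorm_nbodyP_le (hℓ : 0 < ℓ) (u : Space) (i : Fin N) (F : Config N → ℂ) (X : Config N) :
    (‖nbodyP ℓ u i F X‖₊ : ℝ≥0∞) ≤
      (ENNReal.ofReal ℓ ^ 3)⁻¹ * ∫⁻ y in slidingBox ℓ u, (‖F (Function.update X i y)‖₊ : ℝ≥0∞) := by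
  have hc : ((‖((ℓ ^ 3)⁻¹ : ℝ)‖₊ : ℝ≥0) : ℝ≥0∞) = (ENNReal.ofReal ℓ ^ 3)⁻¹ := by
    rw [← enorm_eq_nnnorm, Real.enorm_eq_ofReal (by positivity),
      ENNReal.ofReal_inv_of_pos (by positivity), ENNReal.ofReal_pow hℓ.le]
  rw [nbodyP, nnnorm_smul, ENNReal.coe_mul, hc]
  gcongr
  simp only [← enorm_eq_nnnorm]
  exact enorm_integral_le_lintegral_enorm _

/-- **`Pᵢ` is a contraction of `L²(Λⁿ)`**: `‖PᵢF‖² ≤ ‖F‖²`. [cite: Fournais2020, (2.5)] -/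
theorem lintegral_nbodyP_sq_le (hℓ : 0 < ℓ) (i : Fin (n + 1)) {F : Config (n + 1) → ℂ}
    (hF : Measurable F) :
    ∫⁻ X in boxConfig (n + 1) ℓ u, (‖nbodyP ℓ u i F X‖₊ : ℝ≥0∞) ^ 2 ≤
      ∫⁻ X in boxConfig (n + 1) ℓ u, (‖F X‖₊ : ℝ≥0∞) ^ 2 := by
  have hℓ3 : ENNReal.ofReal ℓ ^ 3 ≠ 0 := pow_ne_zero _ (by rwa [Ne, ENNReal.ofReal_eq_zero, not_le])
  have hℓ3' : ENNReal.ofReal ℓ ^ 3 ≠ ⊤ := ENNReal.pow_ne_top ENNReal.ofReal_ne_top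
  have hm : Measurable fun X : Config (n + 1) => (‖F X‖₊ : ℝ≥0∞) ^ 2 :=
    hF.nnnorm.coe_nnreal_ennreal.pow_const _
  calc ∫⁻ X in boxConfig (n + 1) ℓ u, (‖nbodyP ℓ u i F X‖₊ : ℝ≥0∞) ^ 2
      ≤ ∫⁻ X in boxConfig (n + 1) ℓ u, (ENNReal.ofReal ℓ ^ 3)⁻¹ *
          ∫⁻ y in slidingBox ℓ u, (‖F (Function.update X i y)‖₊ : ℝ≥0∞) ^ 2 :=
        lintegral_mono fun X => nnnorm_nbodyP_sq_le hℓ u i hF X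
    _ = (ENNReal.ofReal ℓ ^ 3)⁻¹ * (ENNReal.ofReal ℓ ^ 3 *
          ∫⁻ X in boxConfig (n + 1) ℓ u, (‖F X‖₊ : ℝ≥0∞) ^ 2) := by
        rw [lintegral_const_mul' _ _ (ENNReal.inv_ne_top.mpr hℓ3),
          lintegral_lintegral_update i (G := fun X => (‖F X‖₊ : ℝ≥0∞) ^ 2) hm]
    _ = ∫⁻ X in boxConfig (n + 1) ℓ u, (‖F X‖₊ : ℝ≥0∞) ^ 2 := by
        rw [← mul_assoc, ENNReal.inv_mul_cancel hℓ3 hℓ3', one_mul]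

/-- **`Pᵢ` is a contraction of `L¹(Λⁿ)`**: `‖PᵢF‖₁ ≤ ‖F‖₁`. [cite: Fournais2020, (2.5)] -/
theorem lintegral_nbodyP_le (hℓ : 0 < ℓ) (i : Fin (n + 1)) {F : Config (n + 1) → ℂ}
    (hF : Measurable F) :
    ∫⁻ X in boxConfig (n + 1) ℓ u, (‖nbodyP ℓ u i F X‖₊ : ℝ≥0∞) ≤
      ∫⁻ X in boxConfig (n + 1) ℓ u, (‖F X‖₊ : ℝ≥0∞) := by
  have hℓ3 : ENNReal.ofReal ℓ ^ 3 ≠ 0 := pow_ne_zero _ (by rwa [Ne, ENNReal.ofReal_eq_zero, not_le])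
  have hℓ3' : ENNReal.ofReal ℓ ^ 3 ≠ ⊤ := ENNReal.pow_ne_top ENNReal.ofReal_ne_top
  have hm : Measurable fun X : Config (n + 1) => (‖F X‖₊ : ℝ≥0∞) := hF.nnnorm.coe_nnreal_ennreal
  calc ∫⁻ X in boxConfig (n + 1) ℓ u, (‖nbodyP ℓ u i F X‖₊ : ℝ≥0∞)
      ≤ ∫⁻ X in boxConfig (n + 1) ℓ u, (ENNReal.ofReal ℓ ^ 3)⁻¹ *
          ∫⁻ y in slidingBox ℓ u, (‖F (Function.update X i y)‖₊ : ℝ≥0∞) :=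
        lintegral_mono fun X => nnnorm_nbodyP_le hℓ u i F X
    _ = (ENNReal.ofReal ℓ ^ 3)⁻¹ * (ENNReal.ofReal ℓ ^ 3 *
          ∫⁻ X in boxConfig (n + 1) ℓ u, (‖F X‖₊ : ℝ≥0∞)) := by
        rw [lintegral_const_mul' _ _ (ENNReal.inv_ne_top.mpr hℓ3),
          lintegral_lintegral_update i (G := fun X => (‖F X‖₊ : ℝ≥0∞)) hm]
    _ = ∫⁻ X in boxConfig (n + 1) ℓ u, (‖F X‖₊ : ℝ≥0∞) := by
        rw [← mul_assoc, ENNReal.inv_mul_cancel hℓ3 hℓ3', one_mul]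

/-- `PᵢF` is integrable on `Λⁿ` when `F` is. [cite: Fournais2020, (2.5)] -/
theorem integrable_nbodyP (hℓ : 0 < ℓ) (i : Fin (n + 1)) {F : Config (n + 1) → ℂ}
    (hFm : Measurable F) (hF : Integrable F (volume.restrict (boxConfig (n + 1) ℓ u))) :
    Integrable (nbodyP ℓ u i F) (volume.restrict (boxConfig (n + 1) ℓ u)) :=
  ⟨(measurable_nbodyP ℓ u i hFm).aestronglyMeasurable,
    lt_of_le_of_lt (by simpa only [hasFiniteIntegral_iff_enorm, enorm_eq_nnnorm] using
      lintegral_nbodyP_le (u := u) hℓ i hFm) hF.2⟩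

/-- **Slices are integrable a.e.**: for `F ∈ L¹(Λⁿ⁺¹)`, `y ↦ F(X; xᵢ = y)` is integrable on `Λ`
for a.e. `X`. [folklore] -/
theorem ae_integrable_update (i : Fin (n + 1)) {F : Config (n + 1) → ℂ}
    (hF : Integrable F (volume.restrict (boxConfig (n + 1) ℓ u))) :
    ∀ᵐ X ∂volume.restrict (boxConfig (n + 1) ℓ u),
      Integrable (fun y => F (Function.update X i y)) (volume.restrict (slidingBox ℓ u)) := by
  set ν : Measure Space := volume.restrict (slidingBox ℓ u) with hν
  set π' : Measure (Config n) := volume.restrict (boxConfig n ℓ u) with hπ'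
  set e := MeasurableEquiv.piFinSuccAbove (fun _ : Fin (n + 1) => Space) i with he_def
  have he := measurePreserving_piFinSuccAbove_box (n := n) i ℓ u
  rw [← hν, ← hπ', ← he_def] at he
  have hKe : Integrable (fun p : Space × Config n => F (e.symm p)) (ν.prod π') :=
    he.symm.integrable_comp_emb e.symm.measurableEmbedding |>.mpr hF
  have h1 : ∀ᵐ X' ∂π', Integrable (fun y => F (e.symm (y, X'))) ν := hKe.prod_left_ae
  have hq : Measure.QuasiMeasurePreserving (fun X : Config (n + 1) => (e X).2)
      (volume.restrict (boxConfig (n + 1) ℓ u)) π' :=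
    Measure.quasiMeasurePreserving_snd.comp he.quasiMeasurePreserving
  filter_upwards [hq.ae h1] with X hX
  refine hX.congr (Filter.Eventually.of_forall fun y => ?_)
  simp only [update_eq_insertNth]
  rfl

/-- **`Pᵢ` is additive a.e.** on `L¹(Λⁿ⁺¹)`. [cite: Fournais2020, (2.5)] -/
theorem nbodyP_add_ae (i : Fin (n + 1)) {F G : Config (n + 1) → ℂ}
    (hF : Integrable F (volume.restrict (boxConfig (n + 1) ℓ u)))
    (hG : Integrable G (volume.restrict (boxConfig (n + 1) ℓ u))) :
    ∀ᵐ X ∂volume.restrict (boxConfig (n + 1) ℓ u),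
      nbodyP ℓ u i (fun Y => F Y + G Y) X = nbodyP ℓ u i F X + nbodyP ℓ u i G X := by
  filter_upwards [ae_integrable_update i hF, ae_integrable_update i hG] with X hFX hGX
  simp only [nbodyP]
  rw [integral_add hFX hGX, smul_add]

/-- **`Pᵢ` is subtractive a.e.** on `L¹(Λⁿ⁺¹)`. [cite: Fournais2020, (2.5)] -/
theorem nbodyP_sub_ae (i : Fin (n + 1)) {F G : Config (n + 1) → ℂ}
    (hF : Integrable F (volume.restrict (boxConfig (n + 1) ℓ u)))
    (hG : Integrable G (volume.restrict (boxConfig (n + 1) ℓ u))) :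
    ∀ᵐ X ∂volume.restrict (boxConfig (n + 1) ℓ u),
      nbodyP ℓ u i (fun Y => F Y - G Y) X = nbodyP ℓ u i F X - nbodyP ℓ u i G X := by
  filter_upwards [ae_integrable_update i hF, ae_integrable_update i hG] with X hFX hGX
  simp only [nbodyP]
  rw [integral_sub hFX hGX, smul_sub]

/-- **`∫ PᵢK = ∫ K`** on `Λⁿ⁺¹` for integrable `K` (Fubini; `Pᵢ` is the conditional expectation
onto the functions of `X̂ᵢ`). [cite: Fournais2020, (2.5)] -/
theorem integral_nbodyP (hℓ : 0 < ℓ) (i : Fin (n + 1)) {K : Config (n + 1) → ℂ}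
    (hK : Integrable K (volume.restrict (boxConfig (n + 1) ℓ u))) :
    ∫ X in boxConfig (n + 1) ℓ u, nbodyP ℓ u i K X = ∫ X in boxConfig (n + 1) ℓ u, K X := by
  simp only [nbodyP]
  rw [integral_smul, integral_integral_update i hK, ← smul_assoc, smul_eq_mul,
    inv_mul_cancel₀ (by positivity), one_smul]

/-- **`⟨H, PᵢG⟩ = ⟨H, G⟩` for `H` not depending on `xᵢ`** (`Pᵢ` is the orthogonal projection onto
such functions): `∫ conj(H)·PᵢG = ∫ conj(H)·G`. [cite: Fournais2020, (2.5)] -/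
theorem integral_conj_mul_nbodyP (hℓ : 0 < ℓ) (i : Fin (n + 1)) {H G : Config (n + 1) → ℂ}
    (hH : ∀ X y, H (Function.update X i y) = H X)
    (hHG : Integrable (fun X => conj (H X) * G X) (volume.restrict (boxConfig (n + 1) ℓ u))) :
    ∫ X in boxConfig (n + 1) ℓ u, conj (H X) * nbodyP ℓ u i G X =
      ∫ X in boxConfig (n + 1) ℓ u, conj (H X) * G X := by
  have h1 : ∀ X, conj (H X) * nbodyP ℓ u i G X = nbodyP ℓ u i (fun Y => conj (H Y) * G Y) X :=
    fun X => (nbodyP_mul_left ℓ u i (H := fun Y => conj (H Y)) (fun X y => by rw [hH]) G X).symm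
  simp only [h1]
  exact integral_nbodyP hℓ i hHG

/-- **`Pᵢ` and `Pⱼ` commute a.e.** on `L¹(Λⁿ⁺¹)` (Fubini on `Λ × Λ`). [cite: Fournais2020, (2.5)] -/
theorem nbodyP_comm_ae {i j : Fin (n + 1)} (hij : i ≠ j) {F : Config (n + 1) → ℂ}
    (hFm : Measurable F) (hF : Integrable F (volume.restrict (boxConfig (n + 1) ℓ u))) :
    ∀ᵐ X ∂volume.restrict (boxConfig (n + 1) ℓ u),
      nbodyP ℓ u i (nbodyP ℓ u j F) X = nbodyP ℓ u j (nbodyP ℓ u i F) X := by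
  -- the double slice `(y, z) ↦ F(X; xᵢ = y, xⱼ = z)` is integrable on `Λ × Λ` for a.e. `X`
  have hm2 : ∀ X : Config (n + 1), Measurable fun p : Space × Space =>
      F (Function.update (Function.update X i p.1) j p.2) := by
    intro X
    have h : Measurable fun p : Space × Space => Function.update (Function.update X i p.1) j p.2 := by
      refine measurable_pi_lambda _ fun k => ?_
      by_cases hkj : k = j
      · subst hkj; simp only [Function.update_self]; exact measurable_snd
      · simp only [Function.update_of_ne hkj]
        by_cases hki : k = i
        · subst hki; simp only [Function.update_self]; exact measurable_fst
        · simp only [Function.update_of_ne hki]; exact measurable_const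
    exact hFm.comp h
  set g : Config (n + 1) → ℝ≥0∞ := fun X => ∫⁻ y in slidingBox ℓ u, ∫⁻ z in slidingBox ℓ u,
    (‖F (Function.update (Function.update X i y) j z)‖₊ : ℝ≥0∞) with hg
  set G₁ : Config (n + 1) → ℝ≥0∞ := fun X => ∫⁻ z in slidingBox ℓ u,
    (‖F (Function.update X j z)‖₊ : ℝ≥0∞) with hG₁
  have hG₁m : Measurable G₁ := by
    refine Measurable.lintegral_prod_right' (f := fun r : Config (n + 1) × Space =>
      (‖F (Function.update r.1 j r.2)‖₊ : ℝ≥0∞)) ?_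
    exact (hFm.comp measurable_update').nnnorm.coe_nnreal_ennreal
  have hgm : Measurable g := by
    refine Measurable.lintegral_prod_right' (f := fun r : Config (n + 1) × Space =>
      G₁ (Function.update r.1 i r.2)) ?_
    exact hG₁m.comp measurable_update'
  have hgi : ∫⁻ X in boxConfig (n + 1) ℓ u, g X ≠ ⊤ := by
    have h1 : ∫⁻ X in boxConfig (n + 1) ℓ u, g X =
        ENNReal.ofReal ℓ ^ 3 * ∫⁻ X in boxConfig (n + 1) ℓ u, G₁ X :=
      lintegral_lintegral_update i hG₁m
    have h2 : ∫⁻ X in boxConfig (n + 1) ℓ u, G₁ X =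
        ENNReal.ofReal ℓ ^ 3 * ∫⁻ X in boxConfig (n + 1) ℓ u, (‖F X‖₊ : ℝ≥0∞) :=
      lintegral_lintegral_update j hFm.nnnorm.coe_nnreal_ennreal
    rw [h1, h2]
    have h3 : ∫⁻ X in boxConfig (n + 1) ℓ u, (‖F X‖₊ : ℝ≥0∞) < ⊤ := by
      simpa only [hasFiniteIntegral_iff_enorm, enorm_eq_nnnorm] using hF.2
    exact ENNReal.mul_ne_top (ENNReal.pow_ne_top ENNReal.ofReal_ne_top)
      (ENNReal.mul_ne_top (ENNReal.pow_ne_top ENNReal.ofReal_ne_top) h3.ne)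
  filter_upwards [ae_lt_top hgm hgi] with X hX
  have hf : Integrable (Function.uncurry fun y z => F (Function.update (Function.update X i y) j z))
      ((volume.restrict (slidingBox ℓ u)).prod (volume.restrict (slidingBox ℓ u))) := by
    refine ⟨(hm2 X).aestronglyMeasurable, ?_⟩
    rw [hasFiniteIntegral_iff_enorm]
    have h := lintegral_prod (μ := volume.restrict (slidingBox ℓ u))
      (ν := volume.restrict (slidingBox ℓ u)) _ (hm2 X).enorm.aemeasurable
    simp only [Function.uncurry_def] at h ⊢
    rw [h]
    simpa only [enorm_eq_nnnorm] using hX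
  have hswap := integral_integral_swap hf
  have h2 : ∀ z y, F (Function.update (Function.update X j z) i y) =
      F (Function.update (Function.update X i y) j z) := fun z y => by
    rw [Function.update_comm hij.symm]
  simp only [nbodyP, h2, integral_smul]
  rw [hswap]

end Projection

/-! ### `L²` bookkeeping: `MemLp`, Pythagoras, orthogonality -/

section L2

variable {N : ℕ}

/-- `∫ ‖F‖² = (∫⁻ ‖F‖²).toReal`. [folklore] -/
theorem integral_norm_sq_eq_toReal {α : Type*} [MeasurableSpace α] {μ : Measure α} {F : α → ℂ}
    (hF : AEStronglyMeasurable F μ) :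
    ∫ x, ‖F x‖ ^ 2 ∂μ = (∫⁻ x, (‖F x‖₊ : ℝ≥0∞) ^ 2 ∂μ).toReal := by
  rw [integral_eq_lintegral_of_nonneg_ae (f := fun x => ‖F x‖ ^ 2)
    (Filter.Eventually.of_forall fun x => by positivity) (hF.norm.pow 2)]
  simp only [← coe_nnnorm_sq_eq_ofReal]

/-- A measurable `F` with `∫ ‖F‖² < ∞` is in `L²`. [folklore] -/
theorem memLp_two_of_lintegral_ne_top {α : Type*} [MeasurableSpace α] {μ : Measure α} {F : α → ℂ}
    (hF : AEStronglyMeasurable F μ) (h : ∫⁻ x, (‖F x‖₊ : ℝ≥0∞) ^ 2 ∂μ ≠ ⊤) : MemLp F 2 μ := by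
  rw [memLp_two_iff_integrable_sq_norm hF]
  refine ⟨hF.norm.pow 2, ?_⟩
  rw [hasFiniteIntegral_iff_enorm]
  calc ∫⁻ x, ‖‖F x‖ ^ 2‖ₑ ∂μ = ∫⁻ x, (‖F x‖₊ : ℝ≥0∞) ^ 2 ∂μ := by
        refine lintegral_congr fun x => ?_
        rw [Real.enorm_eq_ofReal (by positivity), ← coe_nnnorm_sq_eq_ofReal]
    _ < ⊤ := h.lt_top

/-- For `F ∈ L²`, `∫ ‖F‖² < ∞`. [folklore] -/
theorem lintegral_ne_top_of_memLp_two {α : Type*} [MeasurableSpace α] {μ : Measure α} {F : α → ℂ}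
    (hF : MemLp F 2 μ) : ∫⁻ x, (‖F x‖₊ : ℝ≥0∞) ^ 2 ∂μ ≠ ⊤ := by
  have h := ((memLp_two_iff_integrable_sq_norm hF.1).mp hF).2
  rw [hasFiniteIntegral_iff_enorm] at h
  refine ne_of_lt (lt_of_le_of_lt (le_of_eq ?_) h)
  refine lintegral_congr fun x => ?_
  rw [Real.enorm_eq_ofReal (by positivity), ← coe_nnnorm_sq_eq_ofReal]

/-- Products of `L²` functions (with a conjugate) are integrable. [folklore] -/
theorem integrable_conj_mul {α : Type*} [MeasurableSpace α] {μ : Measure α} {F G : α → ℂ}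
    (hF : MemLp F 2 μ) (hG : MemLp G 2 μ) : Integrable (fun x => conj (F x) * G x) μ := by
  have h : Integrable (fun x => F x * G x) μ := hF.integrable_mul hG
  refine h.norm.mono' ((Complex.continuous_conj.comp_aestronglyMeasurable hF.1).mul hG.1)
    (Filter.Eventually.of_forall fun x => ?_)
  rw [norm_mul, norm_mul, Complex.norm_conj]

/-- `|p + q|² = |p|² + |q|² + 2 Re(conj(p) q)`. [folklore] -/
theorem norm_add_sq_complex (p q : ℂ) :
    ‖p + q‖ ^ 2 = ‖p‖ ^ 2 + ‖q‖ ^ 2 + 2 * (conj p * q).re := by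
  have h : (conj p * q).re = (p * conj q).re := by
    rw [← Complex.conj_re (conj p * q), map_mul, Complex.conj_conj]
  rw [h, Complex.sq_norm, Complex.sq_norm, Complex.sq_norm, Complex.normSq_add]

/-- `PᵢF ∈ L²` for `F ∈ L²`. [cite: Fournais2020, (2.5)] -/
theorem memLp_nbodyP (hℓ : 0 < ℓ) (i : Fin (n + 1)) {F : Config (n + 1) → ℂ} (hFm : Measurable F)
    (hF : MemLp F 2 (volume.restrict (boxConfig (n + 1) ℓ u))) :
    MemLp (nbodyP ℓ u i F) 2 (volume.restrict (boxConfig (n + 1) ℓ u)) :=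
  memLp_two_of_lintegral_ne_top (measurable_nbodyP ℓ u i hFm).aestronglyMeasurable
    (ne_top_of_le_ne_top (lintegral_ne_top_of_memLp_two hF) (lintegral_nbodyP_sq_le hℓ i hFm))

/-- `QᵢF ∈ L²` for `F ∈ L²`. [cite: Fournais2020, (2.5)] -/
theorem memLp_nbodyQ (hℓ : 0 < ℓ) (i : Fin (n + 1)) {F : Config (n + 1) → ℂ} (hFm : Measurable F)
    (hF : MemLp F 2 (volume.restrict (boxConfig (n + 1) ℓ u))) :
    MemLp (nbodyQ ℓ u i F) 2 (volume.restrict (boxConfig (n + 1) ℓ u)) :=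
  hF.sub (memLp_nbodyP hℓ i hFm hF)

/-- On the finite measure space `Λⁿ`, `L² ⊂ L¹`. [folklore] -/
theorem integrable_of_memLp_two {F : Config N → ℂ}
    (hF : MemLp F 2 (volume.restrict (boxConfig N ℓ u))) :
    Integrable F (volume.restrict (boxConfig N ℓ u)) := by
  haveI := isFiniteMeasure_restrict_slidingBox ℓ u
  haveI : IsFiniteMeasure (volume.restrict (boxConfig N ℓ u)) := by
    rw [volume_restrict_boxConfig]
    infer_instance
  exact hF.integrable one_le_two

/-- **Orthogonality `⟨PᵢF, QᵢF⟩ = 0`.** [cite: Fournais2020, (2.5)] -/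
theorem integral_conj_nbodyP_mul_nbodyQ (hℓ : 0 < ℓ) (i : Fin (n + 1)) {F : Config (n + 1) → ℂ}
    (hFm : Measurable F) (hF : MemLp F 2 (volume.restrict (boxConfig (n + 1) ℓ u))) :
    ∫ X in boxConfig (n + 1) ℓ u, conj (nbodyP ℓ u i F X) * nbodyQ ℓ u i F X = 0 := by
  have hP := memLp_nbodyP hℓ i hFm hF
  have h1 : ∀ X, conj (nbodyP ℓ u i F X) * nbodyQ ℓ u i F X =
      conj (nbodyP ℓ u i F X) * F X - conj (nbodyP ℓ u i F X) * nbodyP ℓ u i F X := fun X => by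
    rw [nbodyQ, mul_sub]
  simp only [h1]
  rw [integral_sub (integrable_conj_mul hP hF) (integrable_conj_mul hP hP),
    ← integral_conj_mul_nbodyP hℓ i (fun X y => nbodyP_update ℓ u i F X y) (integrable_conj_mul hP hF),
    sub_self]

/-- **Pythagoras `‖F‖² = ‖PᵢF‖² + ‖QᵢF‖²`** on `L²(Λⁿ⁺¹)`. [cite: Fournais2020, (2.5)] -/
theorem integral_norm_sq_eq_add (hℓ : 0 < ℓ) (i : Fin (n + 1)) {F : Config (n + 1) → ℂ}
    (hFm : Measurable F) (hF : MemLp F 2 (volume.restrict (boxConfig (n + 1) ℓ u))) :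
    ∫ X in boxConfig (n + 1) ℓ u, ‖F X‖ ^ 2 =
      (∫ X in boxConfig (n + 1) ℓ u, ‖nbodyP ℓ u i F X‖ ^ 2) +
        ∫ X in boxConfig (n + 1) ℓ u, ‖nbodyQ ℓ u i F X‖ ^ 2 := by
  have hP := memLp_nbodyP hℓ i hFm hF
  have hQ := memLp_nbodyQ hℓ i hFm hF
  have h1 : ∀ X, ‖F X‖ ^ 2 = ‖nbodyP ℓ u i F X‖ ^ 2 + ‖nbodyQ ℓ u i F X‖ ^ 2 +
      2 * (conj (nbodyP ℓ u i F X) * nbodyQ ℓ u i F X).re := fun X => by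
    rw [← norm_add_sq_complex, nbodyQ, add_sub_cancel]
  simp only [h1]
  have hiP : Integrable (fun X => ‖nbodyP ℓ u i F X‖ ^ 2) (volume.restrict (boxConfig (n + 1) ℓ u)) :=
    hP.integrable_norm_pow two_ne_zero
  have hiQ : Integrable (fun X => ‖nbodyQ ℓ u i F X‖ ^ 2) (volume.restrict (boxConfig (n + 1) ℓ u)) :=
    hQ.integrable_norm_pow two_ne_zero
  have hiPQ : Integrable (fun X => 2 * (conj (nbodyP ℓ u i F X) * nbodyQ ℓ u i F X).re)
      (volume.restrict (boxConfig (n + 1) ℓ u)) :=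
    ((integrable_conj_mul hP hQ).re).const_mul 2
  rw [integral_add (f := fun X => ‖nbodyP ℓ u i F X‖ ^ 2 + ‖nbodyQ ℓ u i F X‖ ^ 2)
    (g := fun X => 2 * (conj (nbodyP ℓ u i F X) * nbodyQ ℓ u i F X).re) (hiP.add hiQ) hiPQ,
    integral_add hiP hiQ, integral_const_mul]
  have h2 : ∫ X in boxConfig (n + 1) ℓ u, (conj (nbodyP ℓ u i F X) * nbodyQ ℓ u i F X).re = 0 := by
    have h := integral_re (integrable_conj_mul hP hQ)
    simp only [RCLike.re_to_complex] at h
    rw [h, integral_conj_nbodyP_mul_nbodyQ hℓ i hFm hF, Complex.zero_re]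
  rw [h2, mul_zero, add_zero]

/-- Pythagoras in `ℝ≥0∞`: `‖F‖² = ‖PᵢF‖² + ‖QᵢF‖²`. [cite: Fournais2020, (2.5)] -/
theorem lintegral_norm_sq_eq_add (hℓ : 0 < ℓ) (i : Fin (n + 1)) {F : Config (n + 1) → ℂ}
    (hFm : Measurable F) (hF : MemLp F 2 (volume.restrict (boxConfig (n + 1) ℓ u))) :
    ∫⁻ X in boxConfig (n + 1) ℓ u, (‖F X‖₊ : ℝ≥0∞) ^ 2 =
      (∫⁻ X in boxConfig (n + 1) ℓ u, (‖nbodyP ℓ u i F X‖₊ : ℝ≥0∞) ^ 2) +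
        ∫⁻ X in boxConfig (n + 1) ℓ u, (‖nbodyQ ℓ u i F X‖₊ : ℝ≥0∞) ^ 2 := by
  have hP := memLp_nbodyP hℓ i hFm hF
  have hQ := memLp_nbodyQ hℓ i hFm hF
  have h := integral_norm_sq_eq_add hℓ i hFm hF
  rw [integral_norm_sq_eq_toReal hF.1, integral_norm_sq_eq_toReal hP.1,
    integral_norm_sq_eq_toReal hQ.1, ← ENNReal.toReal_add (lintegral_ne_top_of_memLp_two hP)
    (lintegral_ne_top_of_memLp_two hQ)] at h
  exact (ENNReal.toReal_eq_toReal_iff' (lintegral_ne_top_of_memLp_two hF)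
    (ENNReal.add_ne_top.mpr ⟨lintegral_ne_top_of_memLp_two hP, lintegral_ne_top_of_memLp_two hQ⟩)).mp h

/-- **`⟨F, QᵢF⟩ = ‖QᵢF‖²`.** [cite: Fournais2020, (2.5)] -/
theorem integral_conj_mul_nbodyQ_self (hℓ : 0 < ℓ) (i : Fin (n + 1)) {F : Config (n + 1) → ℂ}
    (hFm : Measurable F) (hF : MemLp F 2 (volume.restrict (boxConfig (n + 1) ℓ u))) :
    ∫ X in boxConfig (n + 1) ℓ u, conj (F X) * nbodyQ ℓ u i F X =
      ((∫ X in boxConfig (n + 1) ℓ u, ‖nbodyQ ℓ u i F X‖ ^ 2 : ℝ) : ℂ) := by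
  have hP := memLp_nbodyP hℓ i hFm hF
  have hQ := memLp_nbodyQ hℓ i hFm hF
  have h1 : ∀ X, conj (F X) * nbodyQ ℓ u i F X =
      conj (nbodyP ℓ u i F X) * nbodyQ ℓ u i F X + ((‖nbodyQ ℓ u i F X‖ ^ 2 : ℝ) : ℂ) := fun X => by
    have hF' : F X = nbodyP ℓ u i F X + nbodyQ ℓ u i F X := by rw [nbodyQ, add_sub_cancel]
    conv_lhs => rw [hF']
    rw [map_add, add_mul, Complex.conj_mul', Complex.ofReal_pow]
  simp only [h1]
  rw [integral_add (integrable_conj_mul hP hQ) ?_, integral_conj_nbodyP_mul_nbodyQ hℓ i hFm hF,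
    zero_add, integral_complex_ofReal]
  exact (hQ.integrable_norm_pow two_ne_zero).ofReal

/-- **`Qᵢ(PⱼF) = Pⱼ(QᵢF)` a.e.** (`i ≠ j`). [cite: Fournais2020, (2.5)] -/
theorem nbodyQ_nbodyP_ae_eq (hℓ : 0 < ℓ) {i j : Fin (n + 1)} (hij : i ≠ j) {F : Config (n + 1) → ℂ}
    (hFm : Measurable F) (hF : Integrable F (volume.restrict (boxConfig (n + 1) ℓ u))) :
    ∀ᵐ X ∂volume.restrict (boxConfig (n + 1) ℓ u),
      nbodyQ ℓ u i (nbodyP ℓ u j F) X = nbodyP ℓ u j (nbodyQ ℓ u i F) X := by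
  filter_upwards [nbodyP_comm_ae hij hFm hF,
    nbodyP_sub_ae j hF (integrable_nbodyP hℓ i hFm hF)] with X h1 h2
  rw [nbodyQ, h1, show nbodyQ ℓ u i F = fun Y => F Y - nbodyP ℓ u i F Y from rfl, h2]

/-- `‖Qᵢ(PⱼF)‖² ≤ ‖QᵢF‖²` (`i ≠ j`). [cite: Fournais2020, (2.5)] -/
theorem lintegral_nbodyQ_nbodyP_sq_le (hℓ : 0 < ℓ) {i j : Fin (n + 1)} (hij : i ≠ j)
    {F : Config (n + 1) → ℂ} (hFm : Measurable F)
    (hF : Integrable F (volume.restrict (boxConfig (n + 1) ℓ u))) :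
    ∫⁻ X in boxConfig (n + 1) ℓ u, (‖nbodyQ ℓ u i (nbodyP ℓ u j F) X‖₊ : ℝ≥0∞) ^ 2 ≤
      ∫⁻ X in boxConfig (n + 1) ℓ u, (‖nbodyQ ℓ u i F X‖₊ : ℝ≥0∞) ^ 2 := by
  calc ∫⁻ X in boxConfig (n + 1) ℓ u, (‖nbodyQ ℓ u i (nbodyP ℓ u j F) X‖₊ : ℝ≥0∞) ^ 2
      = ∫⁻ X in boxConfig (n + 1) ℓ u, (‖nbodyP ℓ u j (nbodyQ ℓ u i F) X‖₊ : ℝ≥0∞) ^ 2 := by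
        refine lintegral_congr_ae ?_
        filter_upwards [nbodyQ_nbodyP_ae_eq hℓ hij hFm hF] with X hX
        rw [hX]
    _ ≤ _ := lintegral_nbodyP_sq_le hℓ j (measurable_nbodyQ ℓ u i hFm)

/-- **`⟨Φ, n₊Φ⟩ = ∑ᵢ ‖QᵢΦ‖²`**: the form `nPlusBoxN` (written with the one-body `Q_u` on slices) is
the sum of the squared norms of the `QᵢΦ` on `Λⁿ⁺¹`. [cite: Fournais2020, (2.15)] -/
theorem nPlusBoxN_eq_sum_lintegral (hℓ : 0 < ℓ) (u : Space) {Φ : Config (n + 1) → ℂ}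
    (hΦ : Measurable Φ) :
    nPlusBoxN ℓ u Φ =
      ∑ i : Fin (n + 1), ∫⁻ X in boxConfig (n + 1) ℓ u, (‖nbodyQ ℓ u i Φ X‖₊ : ℝ≥0∞) ^ 2 := by
  have hℓ3 : ENNReal.ofReal ℓ ^ 3 ≠ 0 := pow_ne_zero _ (by rwa [Ne, ENNReal.ofReal_eq_zero, not_le])
  have hℓ3' : ENNReal.ofReal ℓ ^ 3 ≠ ⊤ := ENNReal.pow_ne_top ENNReal.ofReal_ne_top
  unfold nPlusBoxN
  refine Finset.sum_congr rfl fun i _ => ?_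
  have h1 : ∀ X : Config (n + 1),
      ∫⁻ x, (‖projQ ℓ u (fun y => Φ (Function.update X i y)) x‖₊ : ℝ≥0∞) ^ 2 =
        ∫⁻ x in slidingBox ℓ u, (‖nbodyQ ℓ u i Φ (Function.update X i x)‖₊ : ℝ≥0∞) ^ 2 := by
    intro X
    rw [← lintegral_indicator (measurableSet_slidingBox ℓ u)]
    refine lintegral_congr fun x => ?_
    by_cases hx : x ∈ slidingBox ℓ u
    · rw [Set.indicator_of_mem hx, projQ_slice_eq_nbodyQ ℓ u i Φ X hx]
    · rw [Set.indicator_of_notMem hx, projQ_eq_zero_of_not_mem _ hx]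
      simp
  simp only [h1]
  rw [lintegral_lintegral_update i (G := fun X => (‖nbodyQ ℓ u i Φ X‖₊ : ℝ≥0∞) ^ 2)
    ((measurable_nbodyQ ℓ u i hΦ).nnnorm.coe_nnreal_ennreal.pow_const _), ← mul_assoc,
    ENNReal.inv_mul_cancel hℓ3 hℓ3', one_mul]

end L2

/-! ### Weights in one or two particle coordinates against functions of the other particles -/

section Weights

/-- **Integrating a one-particle weight against a function of the other particles**:
`∫_{Λⁿ⁺¹} g(xᵢ) G(X) dX = ℓ⁻³ (∫_Λ g) ∫_{Λⁿ⁺¹} G` for `G` not depending on `xᵢ`.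
[cite: Fournais2020, remark preceding Lemma 2.3 ("`PᵢF(xᵢ,y)Pᵢ = ℓ⁻³Pᵢ∫F(x,y)dx`")] -/
theorem lintegral_weight_mul (hℓ : 0 < ℓ) (i : Fin (n + 1)) {g : Space → ℝ≥0∞} (hg : Measurable g)
    {G : Config (n + 1) → ℝ≥0∞} (hGm : Measurable G) (hG : ∀ X y, G (Function.update X i y) = G X) :
    ∫⁻ X in boxConfig (n + 1) ℓ u, g (X i) * G X =
      (ENNReal.ofReal ℓ ^ 3)⁻¹ * (∫⁻ y in slidingBox ℓ u, g y) *
        ∫⁻ X in boxConfig (n + 1) ℓ u, G X := by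
  have hℓ3 : ENNReal.ofReal ℓ ^ 3 ≠ 0 := pow_ne_zero _ (by rwa [Ne, ENNReal.ofReal_eq_zero, not_le])
  have hℓ3' : ENNReal.ofReal ℓ ^ 3 ≠ ⊤ := ENNReal.pow_ne_top ENNReal.ofReal_ne_top
  have hKm : Measurable fun X : Config (n + 1) => g (X i) * G X :=
    (hg.comp (measurable_pi_apply i)).mul hGm
  have h := lintegral_lintegral_update (ℓ := ℓ) (u := u) i hKm
  have h1 : ∀ X : Config (n + 1), ∫⁻ y in slidingBox ℓ u, g (Function.update X i y i) * G (Function.update X i y) =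
      (∫⁻ y in slidingBox ℓ u, g y) * G X := by
    intro X
    simp only [Function.update_self, hG]
    rw [lintegral_mul_const _ hg]
  simp only [h1] at h
  rw [lintegral_const_mul _ hGm] at h
  rw [mul_assoc, h, ← mul_assoc, ENNReal.inv_mul_cancel hℓ3 hℓ3', one_mul]

/-- **Integrating a pair weight in the coordinate the function does not see**:
`∫_{Λⁿ⁺¹} ω(xᵢ,xⱼ) G(X) dX = ℓ⁻³ ∫_{Λⁿ⁺¹} (∫_Λ ω(y,xⱼ)dy) G(X) dX` for `G` not depending on `xᵢ`
(`i ≠ j`). [cite: Fournais2020, remark preceding Lemma 2.3] -/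
theorem lintegral_pairWeight_mul (hℓ : 0 < ℓ) {i j : Fin (n + 1)} (hij : i ≠ j)
    {w : Space → Space → ℝ≥0∞} (hw : Measurable fun p : Space × Space => w p.1 p.2)
    {G : Config (n + 1) → ℝ≥0∞} (hGm : Measurable G) (hG : ∀ X y, G (Function.update X i y) = G X) :
    ∫⁻ X in boxConfig (n + 1) ℓ u, w (X i) (X j) * G X =
      (ENNReal.ofReal ℓ ^ 3)⁻¹ *
        ∫⁻ X in boxConfig (n + 1) ℓ u, (∫⁻ y in slidingBox ℓ u, w y (X j)) * G X := by
  have hℓ3 : ENNReal.ofReal ℓ ^ 3 ≠ 0 := pow_ne_zero _ (by rwa [Ne, ENNReal.ofReal_eq_zero, not_le])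
  have hℓ3' : ENNReal.ofReal ℓ ^ 3 ≠ ⊤ := ENNReal.pow_ne_top ENNReal.ofReal_ne_top
  have hwij : Measurable fun X : Config (n + 1) => w (X i) (X j) := by
    have h1 : Measurable fun X : Config (n + 1) => (X i, X j) :=
      (measurable_pi_apply i).prodMk (measurable_pi_apply j)
    exact hw.comp h1
  have hKm : Measurable fun X : Config (n + 1) => w (X i) (X j) * G X := hwij.mul hGm
  have h := lintegral_lintegral_update (ℓ := ℓ) (u := u) i hKm
  have h1 : ∀ X : Config (n + 1), ∫⁻ y in slidingBox ℓ u,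
      w (Function.update X i y i) (Function.update X i y j) * G (Function.update X i y) =
      (∫⁻ y in slidingBox ℓ u, w y (X j)) * G X := by
    intro X
    simp only [Function.update_self, Function.update_of_ne hij.symm, hG]
    rw [lintegral_mul_const _ ?_]
    exact hw.comp (measurable_id.prodMk measurable_const)
  simp only [h1] at h
  rw [h, ← mul_assoc, ENNReal.inv_mul_cancel hℓ3 hℓ3', one_mul]

/-- The `xⱼ`-marginal `X ↦ ∫_Λ ω(y, xⱼ) dy` of a measurable pair weight is measurable. [folklore] -/
theorem measurable_lintegral_pairWeight (j : Fin (n + 1)) {w : Space → Space → ℝ≥0∞}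
    (hw : Measurable fun p : Space × Space => w p.1 p.2) :
    Measurable fun X : Config (n + 1) => ∫⁻ y in slidingBox ℓ u, w y (X j) := by
  have h : Measurable fun X : Config (n + 1) => ∫⁻ y in slidingBox ℓ u, w y (X j) ∂volume := by
    refine Measurable.lintegral_prod_right' (f := fun r : Config (n + 1) × Space => w r.2 (r.1 j))
      (ν := volume.restrict (slidingBox ℓ u)) ?_
    exact hw.comp (measurable_snd.prodMk ((measurable_pi_apply j).comp measurable_fst))
  exact h

/-- **Pair weights against functions not depending on `xᵢ` are controlled by `sup_x ∫ω(y,x)dy`**: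
`∫ ω(xᵢ,xⱼ)|G|² ≤ ℓ⁻³ K ‖G‖²` if `∫_Λ ω(y,x) dy ≤ K` for all `x`. [cite: Fournais2020, remark preceding Lemma 2.3] -/
theorem lintegral_pairWeight_mul_le (hℓ : 0 < ℓ) {i j : Fin (n + 1)} (hij : i ≠ j)
    {w : Space → Space → ℝ≥0∞} (hw : Measurable fun p : Space × Space => w p.1 p.2) {K : ℝ≥0∞}
    (hK : ∀ x, ∫⁻ y in slidingBox ℓ u, w y x ≤ K)
    {G : Config (n + 1) → ℝ≥0∞} (hGm : Measurable G) (hG : ∀ X y, G (Function.update X i y) = G X) :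
    ∫⁻ X in boxConfig (n + 1) ℓ u, w (X i) (X j) * G X ≤
      (ENNReal.ofReal ℓ ^ 3)⁻¹ * K * ∫⁻ X in boxConfig (n + 1) ℓ u, G X := by
  rw [lintegral_pairWeight_mul hℓ hij hw hGm hG, mul_assoc, ← lintegral_const_mul _ hGm]
  gcongr with X
  exact hK _

end Weights

/-! ### The localised potentials `w, w₁, w₂` (2.8)–(2.10) -/

section Potentials

variable {v : ℝ → ℝ≥0∞} {ω : Space → ℝ} {χ : Space → ℝ}

/-- `w₁(x,y) = w(x,y)(1 - ω(x-y))` (2.8). [cite: Fournais2020, (2.8)] -/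
theorem pairLoc₁_eq_pairLoc_mul (v : ℝ → ℝ≥0∞) (ω : Space → ℝ) (χ : Space → ℝ) (ℓ : ℝ)
    (u x y : Space) :
    pairLoc₁ v ω χ ℓ u x y = pairLoc v χ ℓ u x y * ENNReal.ofReal (1 - ω (x - y)) := by
  unfold pairLoc₁ pairLoc bigW₁ bigW
  simp only [div_eq_mul_inv]
  ring

/-- `w₁ ≤ w` (`0 ≤ ω ≤ 1`). [cite: Fournais2020, (2.8), (A.2)] -/
theorem pairLoc₁_le_pairLoc (hω : IsScatteringSolution v ω) (χ : Space → ℝ) (ℓ : ℝ)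
    (u x y : Space) : pairLoc₁ v ω χ ℓ u x y ≤ pairLoc v χ ℓ u x y := by
  rw [pairLoc₁_eq_pairLoc_mul]
  calc pairLoc v χ ℓ u x y * ENNReal.ofReal (1 - ω (x - y)) ≤ pairLoc v χ ℓ u x y * 1 := by
        gcongr
        exact ENNReal.ofReal_le_one.mpr (by linarith [hω.nonneg (x - y)])
    _ = _ := mul_one _

/-- `w₁` is symmetric: `w₁(x,y) = w₁(y,x)` (`ω` radial). [cite: Fournais2020, (2.8)] -/
theorem pairLoc₁_comm (hω : IsScatteringSolution v ω) (hχ : IsLocalizationFunction χ) (ℓ : ℝ)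
    (u x y : Space) : pairLoc₁ v ω χ ℓ u x y = pairLoc₁ v ω χ ℓ u y x := by
  rw [pairLoc₁_eq_pairLoc_mul, pairLoc₁_eq_pairLoc_mul, pairLoc_comm hχ,
    hω.radial (x - y) (y - x) (by rw [← neg_sub, norm_neg])]

/-- `ω(x - y) = ω(y - x)` (`ω` radial). [cite: Fournais2020, (A.2)] -/
theorem IsScatteringSolution.sub_comm (hω : IsScatteringSolution v ω) (x y : Space) :
    ω (x - y) = ω (y - x) :=
  hω.radial (x - y) (y - x) (by rw [← neg_sub, norm_neg])

/-- Off the box `Λ(u)` (in the second variable) `w₁` vanishes. [cite: Fournais2020, (2.8)] -/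
theorem pairLoc₁_eq_zero_of_not_mem_right (hχ : IsLocalizationFunction χ) (hℓ : 0 < ℓ)
    {u y : Space} (x : Space) (hy : y ∉ slidingBox ℓ u) : pairLoc₁ v ω χ ℓ u x y = 0 := by
  simp [pairLoc₁, locFun_eq_zero_of_not_mem hχ hℓ hy]

/-- A set integral over `Λ(u)` of a function vanishing off `Λ(u)` is the full integral. [folklore] -/
theorem setLIntegral_slidingBox_eq {f : Space → ℝ≥0∞} (hf : ∀ x ∉ slidingBox ℓ u, f x = 0) :
    ∫⁻ x in slidingBox ℓ u, f x = ∫⁻ x, f x := by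
  rw [← lintegral_indicator (measurableSet_slidingBox ℓ u)]
  refine lintegral_congr fun x => ?_
  by_cases hx : x ∈ slidingBox ℓ u
  · rw [Set.indicator_of_mem hx]
  · rw [Set.indicator_of_notMem hx, hf x hx]

/-- `W ≤ 2v` for `R/ℓ` small (`χ*χ ≥ ½` on `B̄(0,D)`, `R/ℓ ≤ D`). [cite: Fournais2020, (2.4), (2.42)] -/
theorem bigW_le_two_mul {R D : ℝ} (hR : ∀ r, R < r → v r = 0) (hℓ : 0 < ℓ)
    (hD : ∀ y : Space, ‖y‖ ≤ D → 2⁻¹ ≤ selfConv χ y) (hRℓ : R / ℓ ≤ D) (z : Space) :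
    bigW v χ ℓ z ≤ 2 * v ‖z‖ := by
  unfold bigW
  by_cases hz : ‖z‖ ≤ R
  · have hsc : 2⁻¹ ≤ selfConv χ (ℓ⁻¹ • z) := by
      refine hD _ ?_
      rw [norm_smul, norm_inv, Real.norm_eq_abs, abs_of_pos hℓ]
      calc ℓ⁻¹ * ‖z‖ ≤ ℓ⁻¹ * R := by gcongr
        _ = R / ℓ := by rw [div_eq_inv_mul]
        _ ≤ D := hRℓ
    have hden : (2⁻¹ : ℝ≥0∞) ≤ ENNReal.ofReal (selfConv χ (ℓ⁻¹ • z)) := by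
      have h2 : (2⁻¹ : ℝ≥0∞) = ENNReal.ofReal 2⁻¹ := by
        rw [ENNReal.ofReal_inv_of_pos two_pos, ENNReal.ofReal_ofNat]
      rw [h2]
      exact ENNReal.ofReal_le_ofReal hsc
    refine ENNReal.div_le_of_le_mul ?_
    calc v ‖z‖ = 2 * v ‖z‖ * 2⁻¹ := by
          rw [mul_comm (2 : ℝ≥0∞), mul_assoc, ENNReal.mul_inv_cancel two_ne_zero ENNReal.ofNat_ne_top,
            mul_one]
      _ ≤ 2 * v ‖z‖ * ENNReal.ofReal (selfConv χ (ℓ⁻¹ • z)) := by gcongr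
  · rw [hR _ (not_le.mp hz), ENNReal.zero_div]
    exact zero_le

/-- **`∫ w(x,y) dy ≤ 2‖χ‖²_∞ ∫v`** for `R/ℓ` small (no finiteness of `∫v` asserted or needed).
[cite: Fournais2020, (2.8)] -/
theorem lintegral_pairLoc_le {R D Cχ : ℝ} (hR : ∀ r, R < r → v r = 0) (hℓ : 0 < ℓ)
    (hCχ : ∀ x, ‖χ x‖ ≤ Cχ) (hD : ∀ y : Space, ‖y‖ ≤ D → 2⁻¹ ≤ selfConv χ y) (hRℓ : R / ℓ ≤ D)
    (x : Space) :
    ∫⁻ y, pairLoc v χ ℓ u x y ≤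
      ENNReal.ofReal Cχ * ENNReal.ofReal Cχ * 2 * ∫⁻ z : Space, v ‖z‖ := by
  have hχb : ∀ z, locFun χ ℓ u z ≤ Cχ := fun z => (Real.le_norm_self _).trans (hCχ _)
  calc ∫⁻ y, pairLoc v χ ℓ u x y
      ≤ ∫⁻ y, ENNReal.ofReal Cχ * (2 * v ‖x - y‖) * ENNReal.ofReal Cχ := by
        refine lintegral_mono fun y => ?_
        unfold pairLoc
        gcongr
        · exact hχb x
        · exact bigW_le_two_mul hR hℓ hD hRℓ _
        · exact hχb y
    _ = ENNReal.ofReal Cχ * ENNReal.ofReal Cχ * 2 * ∫⁻ y, v ‖x - y‖ := by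
        rw [← lintegral_const_mul' _ _ (by finiteness)]
        refine lintegral_congr fun y => ?_
        ring
    _ = ENNReal.ofReal Cχ * ENNReal.ofReal Cχ * 2 * ∫⁻ z : Space, v ‖z‖ := by
        rw [lintegral_sub_left_eq_self (μ := (volume : Measure Space)) (fun z => v ‖z‖) x]

/-- `∫ χ_Λ(x) χ_Λ(x - z) dx = ℓ³ (χ*χ)(z/ℓ)`. [cite: Fournais2020, (2.10)] -/
theorem lintegral_locFun_mul_locFun_sub (hχ : IsLocalizationFunction χ) (hℓ : 0 < ℓ) (u z : Space) :
    ∫⁻ x, ENNReal.ofReal (locFun χ ℓ u x) * ENNReal.ofReal (locFun χ ℓ u (x - z)) =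
      ENNReal.ofReal (ℓ ^ 3) * ENNReal.ofReal (selfConv χ (ℓ⁻¹ • z)) := by
  have hcomm : ∀ a b : Space, locFun χ ℓ a b = locFun χ ℓ b a := fun a b => by
    unfold locFun
    rw [← hχ.even, ← smul_neg, neg_sub]
  have h := lintegral_locFun_mul_locFun hχ hℓ u (u + z)
  rw [show u - (u + z) = -z by abel, smul_neg, hχ.selfConv_neg] at h
  have hrw : ∀ x, locFun χ ℓ u (x - z) = locFun χ ℓ x (u + z) := fun x => by
    unfold locFun
    rw [← hχ.even (ℓ⁻¹ • (u + z - x)), ← smul_neg]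
    congr 1
    abel
  calc ∫⁻ x, ENNReal.ofReal (locFun χ ℓ u x) * ENNReal.ofReal (locFun χ ℓ u (x - z))
      = ∫⁻ x, ENNReal.ofReal (locFun χ ℓ x u) * ENNReal.ofReal (locFun χ ℓ x (u + z)) :=
        lintegral_congr fun x => by rw [hcomm u x, hrw x]
    _ = _ := h

/-- **The double integrals of the localised potentials** (2.10): for `R/ℓ` small and measurable
`h ≥ 0`, `∬ w₁(x,y) h(x-y) dx dy = ℓ³ ∫ g(z) h(z) dz` (`g = v(1-ω)`): the `x`-integral of
`χ_Λ(x)χ_Λ(x-z)` is `ℓ³(χ*χ)(z/ℓ)`, which cancels the denominator of `W₁` on `supp g`.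
[cite: Fournais2020, (2.10)] -/
theorem lintegral_lintegral_pairLoc₁_mul (hχ : IsLocalizationFunction χ) (hω : IsScatteringSolution v ω)
    (hvm : Measurable v) {R D : ℝ} (hR : ∀ r, R < r → v r = 0) (hℓ : 0 < ℓ)
    (hD : ∀ y : Space, ‖y‖ ≤ D → 2⁻¹ ≤ selfConv χ y) (hRℓ : R / ℓ ≤ D) (u : Space)
    {h : Space → ℝ≥0∞} (hh : Measurable h) :
    ∫⁻ x, ∫⁻ y, pairLoc₁ v ω χ ℓ u x y * h (x - y) =
      ENNReal.ofReal (ℓ ^ 3) * ∫⁻ z, v ‖z‖ * ENNReal.ofReal (1 - ω z) * h z := by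
  have hmχ : ∀ w, Measurable fun x => ENNReal.ofReal (locFun χ ℓ w x) := fun w =>
    (measurable_locFun_right hχ ℓ w).ennreal_ofReal
  have hmW : Measurable (bigW₁ v ω χ ℓ) := measurable_bigW₁ hvm hω.measurable hχ ℓ
  -- `y = x - z`
  have h1 : ∀ x, ∫⁻ y, pairLoc₁ v ω χ ℓ u x y * h (x - y) =
      ∫⁻ z, ENNReal.ofReal (locFun χ ℓ u x) * bigW₁ v ω χ ℓ z *
        ENNReal.ofReal (locFun χ ℓ u (x - z)) * h z := by
    intro x
    rw [← lintegral_sub_left_eq_self (μ := (volume : Measure Space))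
      (fun y => pairLoc₁ v ω χ ℓ u x y * h (x - y)) x]
    refine lintegral_congr fun z => ?_
    simp only [pairLoc₁, sub_sub_cancel]
  simp only [h1]
  -- Tonelli
  rw [lintegral_lintegral_swap]
  swap
  · exact (((((hmχ u).comp measurable_fst).mul (hmW.comp measurable_snd)).mul
      ((hmχ u).comp (measurable_fst.sub measurable_snd))).mul (hh.comp measurable_snd)).aemeasurable
  -- the `x`-integral
  have h2 : ∀ z, ∫⁻ x, ENNReal.ofReal (locFun χ ℓ u x) * bigW₁ v ω χ ℓ z *
      ENNReal.ofReal (locFun χ ℓ u (x - z)) * h z =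
      bigW₁ v ω χ ℓ z * h z * (ENNReal.ofReal (ℓ ^ 3) * ENNReal.ofReal (selfConv χ (ℓ⁻¹ • z))) := by
    intro z
    have hm2 : Measurable fun x => ENNReal.ofReal (locFun χ ℓ u x) *
        ENNReal.ofReal (locFun χ ℓ u (x - z)) := by
      have h := (hmχ u).mul ((hmχ u).comp (measurable_sub_const z))
      exact h
    rw [← lintegral_locFun_mul_locFun_sub hχ hℓ u z, ← lintegral_const_mul _ hm2]
    exact lintegral_congr fun x => by ring
  simp only [h2]
  -- cancellation of the denominator of `W₁` on `supp g`
  have h3 : ∀ z, bigW₁ v ω χ ℓ z * h z * (ENNReal.ofReal (ℓ ^ 3) * ENNReal.ofReal (selfConv χ (ℓ⁻¹ • z))) =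
      ENNReal.ofReal (ℓ ^ 3) * (v ‖z‖ * ENNReal.ofReal (1 - ω z) * h z) := by
    intro z
    unfold bigW₁
    by_cases hz : ‖z‖ ≤ R
    · have hpos : 0 < selfConv χ (ℓ⁻¹ • z) := by
        refine lt_of_lt_of_le (by norm_num) (hD _ ?_)
        rw [norm_smul, norm_inv, Real.norm_eq_abs, abs_of_pos hℓ]
        calc ℓ⁻¹ * ‖z‖ ≤ ℓ⁻¹ * R := by gcongr
          _ = R / ℓ := by rw [div_eq_inv_mul]
          _ ≤ D := hRℓ
      have hne : ENNReal.ofReal (selfConv χ (ℓ⁻¹ • z)) ≠ 0 := by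
        rw [Ne, ENNReal.ofReal_eq_zero, not_le]; exact hpos
      calc v ‖z‖ * ENNReal.ofReal (1 - ω z) / ENNReal.ofReal (selfConv χ (ℓ⁻¹ • z)) * h z *
            (ENNReal.ofReal (ℓ ^ 3) * ENNReal.ofReal (selfConv χ (ℓ⁻¹ • z)))
          = ENNReal.ofReal (ℓ ^ 3) * (v ‖z‖ * ENNReal.ofReal (1 - ω z) * h z) *
              (ENNReal.ofReal (selfConv χ (ℓ⁻¹ • z)))⁻¹ * ENNReal.ofReal (selfConv χ (ℓ⁻¹ • z)) := by
            simp only [div_eq_mul_inv]; ring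
        _ = _ := by rw [mul_assoc, ENNReal.inv_mul_cancel hne ENNReal.ofReal_ne_top, mul_one]
    · rw [hR _ (not_le.mp hz)]
      simp
  simp only [h3]
  rw [lintegral_const_mul' _ _ ENNReal.ofReal_ne_top]

/-- **(2.10), first identity**: `∬ w₁ = ℓ³ ∫g = 8πaℓ³`. [cite: Fournais2020, (2.10)] -/
theorem lintegral_lintegral_pairLoc₁ (hχ : IsLocalizationFunction χ) (hω : IsScatteringSolution v ω)
    (hvm : Measurable v) {R D : ℝ} (hR : ∀ r, R < r → v r = 0) (hℓ : 0 < ℓ)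
    (hD : ∀ y : Space, ‖y‖ ≤ D → 2⁻¹ ≤ selfConv χ y) (hRℓ : R / ℓ ≤ D) (u : Space) :
    ∫⁻ x, ∫⁻ y, pairLoc₁ v ω χ ℓ u x y =
      ENNReal.ofReal (ℓ ^ 3) * (ENNReal.ofReal (8 * Real.pi) * scatteringLength v) := by
  have h := lintegral_lintegral_pairLoc₁_mul hχ hω hvm hR hℓ hD hRℓ u (h := fun _ => 1)
    measurable_const
  simp only [mul_one] at h
  rw [h, hω.lintegral_g]

/-- **(2.10), second identity**: `∬ w₂ = ∬ w₁(1 + ω) = ℓ³(∫g + ∫gω) = ℓ³(8πa + ∫gω)`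
(`w₂ = w(1 - ω²) = w₁(1 + ω)`). [cite: Fournais2020, (2.9)–(2.10)] -/
theorem lintegral_lintegral_pairLoc₂ (hχ : IsLocalizationFunction χ) (hω : IsScatteringSolution v ω)
    (hvm : Measurable v) {R D : ℝ} (hR : ∀ r, R < r → v r = 0) (hℓ : 0 < ℓ)
    (hD : ∀ y : Space, ‖y‖ ≤ D → 2⁻¹ ≤ selfConv χ y) (hRℓ : R / ℓ ≤ D) (u : Space) :
    ∫⁻ x, ∫⁻ y, pairLoc₁ v ω χ ℓ u x y * ENNReal.ofReal (1 + ω (x - y)) =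
      ENNReal.ofReal (ℓ ^ 3) *
        (ENNReal.ofReal (8 * Real.pi) * scatteringLength v + gOmegaIntegral v ω) := by
  have h := lintegral_lintegral_pairLoc₁_mul hχ hω hvm hR hℓ hD hRℓ u
    (h := fun z => ENNReal.ofReal (1 + ω z)) (measurable_const.add hω.measurable).ennreal_ofReal
  have hgm : Measurable fun x : Space => v ‖x‖ * ENNReal.ofReal (1 - ω x) :=
    (hvm.comp measurable_norm).mul (measurable_const.sub hω.measurable).ennreal_ofReal
  rw [h, ← hω.lintegral_g, gOmegaIntegral, ← lintegral_add_left hgm]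
  congr 1
  refine lintegral_congr fun z => ?_
  have h0 := hω.nonneg z
  have h1 := hω.le_one z
  rw [mul_assoc, ← ENNReal.ofReal_mul (by linarith), ← mul_add, ← ENNReal.ofReal_add (by linarith)
    (by nlinarith)]
  congr 2
  ring

end Potentials

/-! ### Real-valued weights: conversion between `∫ W.toReal |a|²` and `∫⁻ W |a|²` -/

section Conversion

variable {α : Type*} [MeasurableSpace α] {μ : Measure α}

/-- `W.toReal |a|² = (W |a|²).toReal`. [folklore] -/
theorem toReal_mul_norm_sq (W : ℝ≥0∞) (a : ℂ) :
    W.toReal * ‖a‖ ^ 2 = (W * (‖a‖₊ : ℝ≥0∞) ^ 2).toReal := by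
  rw [ENNReal.toReal_mul, ENNReal.toReal_pow, ENNReal.coe_toReal, coe_nnnorm]

/-- `x ↦ W(x).toReal |a(x)|²` is integrable when `∫⁻ W|a|² < ∞`. [folklore] -/
theorem integrable_toReal_mul_norm_sq {W : α → ℝ≥0∞} (hW : AEMeasurable W μ) {a : α → ℂ}
    (ha : AEStronglyMeasurable a μ) (h : ∫⁻ x, W x * (‖a x‖₊ : ℝ≥0∞) ^ 2 ∂μ ≠ ⊤) :
    Integrable (fun x => (W x).toReal * ‖a x‖ ^ 2) μ := by
  have hm : AEMeasurable (fun x => W x * (‖a x‖₊ : ℝ≥0∞) ^ 2) μ :=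
    hW.mul (ha.aemeasurable.nnnorm.coe_nnreal_ennreal.pow_const _)
  have hi := integrable_toReal_of_lintegral_ne_top hm h
  refine hi.congr (Filter.Eventually.of_forall fun x => ?_)
  simp only [toReal_mul_norm_sq]

/-- `∫ W.toReal |a|² = (∫⁻ W |a|²).toReal` when the right side is finite. [folklore] -/
theorem integral_toReal_mul_norm_sq {W : α → ℝ≥0∞} (hW : AEMeasurable W μ) {a : α → ℂ}
    (ha : AEStronglyMeasurable a μ) (h : ∫⁻ x, W x * (‖a x‖₊ : ℝ≥0∞) ^ 2 ∂μ ≠ ⊤) :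
    ∫ x, (W x).toReal * ‖a x‖ ^ 2 ∂μ = (∫⁻ x, W x * (‖a x‖₊ : ℝ≥0∞) ^ 2 ∂μ).toReal := by
  have hm : AEMeasurable (fun x => W x * (‖a x‖₊ : ℝ≥0∞) ^ 2) μ :=
    hW.mul (ha.aemeasurable.nnnorm.coe_nnreal_ennreal.pow_const _)
  simp only [toReal_mul_norm_sq]
  exact integral_toReal hm (ae_lt_top' hm h)

/-- `x ↦ W(x).toReal conj(a(x)) b(x)` is integrable when `∫⁻ W|a|², ∫⁻ W|b|² < ∞`
(`|W conj(a) b| ≤ W(|a|² + |b|²)/2`). [folklore] -/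
theorem integrable_toReal_mul_conj_mul {W : α → ℝ≥0∞} (hW : AEMeasurable W μ) {a b : α → ℂ}
    (ha : AEStronglyMeasurable a μ) (hb : AEStronglyMeasurable b μ)
    (ha' : ∫⁻ x, W x * (‖a x‖₊ : ℝ≥0∞) ^ 2 ∂μ ≠ ⊤) (hb' : ∫⁻ x, W x * (‖b x‖₊ : ℝ≥0∞) ^ 2 ∂μ ≠ ⊤) :
    Integrable (fun x => ((W x).toReal : ℂ) * (conj (a x) * b x)) μ := by
  have hi := ((integrable_toReal_mul_norm_sq hW ha ha').add (integrable_toReal_mul_norm_sq hW hb hb')).div_const 2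
  refine hi.mono' ?_ (Filter.Eventually.of_forall fun x => ?_)
  · exact (Complex.continuous_ofReal.comp_aestronglyMeasurable
      hW.ennreal_toReal.aestronglyMeasurable).mul
      ((Complex.continuous_conj.comp_aestronglyMeasurable ha).mul hb)
  · rw [norm_mul, norm_mul, Complex.norm_conj, Complex.norm_real, Real.norm_of_nonneg ENNReal.toReal_nonneg]
    simp only [Pi.add_apply]
    have h0 : 0 ≤ (W x).toReal := ENNReal.toReal_nonneg
    nlinarith [sq_nonneg (‖a x‖ - ‖b x‖), mul_nonneg h0 (sq_nonneg (‖a x‖ - ‖b x‖))]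

/-- Real part version: `x ↦ W(x).toReal Re(conj(a(x)) b(x))` is integrable. [folklore] -/
theorem integrable_toReal_mul_re {W : α → ℝ≥0∞} (hW : AEMeasurable W μ) {a b : α → ℂ}
    (ha : AEStronglyMeasurable a μ) (hb : AEStronglyMeasurable b μ)
    (ha' : ∫⁻ x, W x * (‖a x‖₊ : ℝ≥0∞) ^ 2 ∂μ ≠ ⊤) (hb' : ∫⁻ x, W x * (‖b x‖₊ : ℝ≥0∞) ^ 2 ∂μ ≠ ⊤) :
    Integrable (fun x => (W x).toReal * (conj (a x) * b x).re) μ := by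
  have h := (integrable_toReal_mul_conj_mul hW ha hb ha' hb').re
  refine h.congr (Filter.Eventually.of_forall fun x => ?_)
  simp only [RCLike.re_to_complex, Complex.re_ofReal_mul]

/-- `|p + q|² ≤ 2|p|² + 2|q|²` in `ℝ≥0∞`. [folklore] -/
theorem ennnorm_add_sq_le (p q : ℂ) :
    ((‖p + q‖₊ : ℝ≥0) : ℝ≥0∞) ^ 2 ≤ 2 * ((‖p‖₊ : ℝ≥0) : ℝ≥0∞) ^ 2 + 2 * ((‖q‖₊ : ℝ≥0) : ℝ≥0∞) ^ 2 := by
  have h1 : ‖p + q‖₊ ^ 2 ≤ 2 * ‖p‖₊ ^ 2 + 2 * ‖q‖₊ ^ 2 := by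
    rw [← NNReal.coe_le_coe]
    push_cast
    nlinarith [norm_add_le p q, sq_nonneg (‖p‖ - ‖q‖), norm_nonneg (p + q), norm_nonneg p,
      norm_nonneg q]
  exact_mod_cast ENNReal.coe_le_coe.mpr h1

/-- `∫⁻ W|a + b|² ≤ 2∫⁻ W|a|² + 2∫⁻ W|b|²`. [folklore] -/
theorem lintegral_mul_norm_sq_add_le {W : α → ℝ≥0∞} (hW : AEMeasurable W μ) {a : α → ℂ}
    (ha : AEStronglyMeasurable a μ) (b : α → ℂ) :
    ∫⁻ x, W x * (‖a x + b x‖₊ : ℝ≥0∞) ^ 2 ∂μ ≤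
      2 * ∫⁻ x, W x * (‖a x‖₊ : ℝ≥0∞) ^ 2 ∂μ + 2 * ∫⁻ x, W x * (‖b x‖₊ : ℝ≥0∞) ^ 2 ∂μ := by
  have hm1 : AEMeasurable (fun x => W x * (‖a x‖₊ : ℝ≥0∞) ^ 2) μ :=
    hW.mul (ha.aemeasurable.nnnorm.coe_nnreal_ennreal.pow_const _)
  have hm : AEMeasurable (fun x => 2 * (W x * (‖a x‖₊ : ℝ≥0∞) ^ 2)) μ := hm1.const_mul _
  rw [← lintegral_const_mul'' 2 hm1, ← lintegral_const_mul' 2 (fun x => W x * (‖b x‖₊ : ℝ≥0∞) ^ 2)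
    ENNReal.ofNat_ne_top, ← lintegral_add_left' hm]
  refine lintegral_mono fun x => ?_
  calc W x * (‖a x + b x‖₊ : ℝ≥0∞) ^ 2
      ≤ W x * (2 * (‖a x‖₊ : ℝ≥0∞) ^ 2 + 2 * (‖b x‖₊ : ℝ≥0∞) ^ 2) := by
        gcongr
        exact ennnorm_add_sq_le _ _
    _ = 2 * (W x * (‖a x‖₊ : ℝ≥0∞) ^ 2) + 2 * (W x * (‖b x‖₊ : ℝ≥0∞) ^ 2) := by ring

/-- `∫⁻ W|a - b|² ≤ 2∫⁻ W|a|² + 2∫⁻ W|b|²`. [folklore] -/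
theorem lintegral_mul_norm_sq_sub_le {W : α → ℝ≥0∞} (hW : AEMeasurable W μ) {a : α → ℂ}
    (ha : AEStronglyMeasurable a μ) (b : α → ℂ) :
    ∫⁻ x, W x * (‖a x - b x‖₊ : ℝ≥0∞) ^ 2 ∂μ ≤
      2 * ∫⁻ x, W x * (‖a x‖₊ : ℝ≥0∞) ^ 2 ∂μ + 2 * ∫⁻ x, W x * (‖b x‖₊ : ℝ≥0∞) ^ 2 ∂μ := by
  have h := lintegral_mul_norm_sq_add_le hW ha (fun x => -b x)
  simp only [← sub_eq_add_neg, nnnorm_neg] at h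
  exact h

/-- `∫⁻ W|a|²` is unchanged under an a.e. modification of `a`. [folklore] -/
theorem lintegral_mul_norm_sq_congr_ae (W : α → ℝ≥0∞) {a b : α → ℂ} (h : ∀ᵐ x ∂μ, a x = b x) :
    ∫⁻ x, W x * (‖a x‖₊ : ℝ≥0∞) ^ 2 ∂μ = ∫⁻ x, W x * (‖b x‖₊ : ℝ≥0∞) ^ 2 ∂μ := by
  refine lintegral_congr_ae ?_
  filter_upwards [h] with x hx
  rw [hx]

end Conversion

/-! ### Finite double sums over ordered pairs `i ≠ j` -/

section Sums

variable {m : ℕ}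

/-- `∑ᵢ ∑_{j ≠ i} f i j = ∑ᵢ ∑ⱼ f i j - ∑ᵢ f i i`. [folklore] -/
theorem sum_sum_filter_ne_eq (f : Fin m → Fin m → ℝ) :
    ∑ i : Fin m, ∑ j : Fin m with j ≠ i, f i j =
      ∑ i : Fin m, ∑ j : Fin m, f i j - ∑ i : Fin m, f i i := by
  rw [← Finset.sum_sub_distrib]
  refine Finset.sum_congr rfl fun i _ => ?_
  rw [Finset.filter_ne', Finset.sum_erase_eq_sub (Finset.mem_univ i)]

/-- `∑ᵢ ∑_{j ≠ i} f i j = ∑ᵢ ∑_{j ≠ i} f j i` (relabelling the ordered pairs). [folklore] -/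
theorem sum_sum_filter_ne_comm (f : Fin m → Fin m → ℝ) :
    ∑ i : Fin m, ∑ j : Fin m with j ≠ i, f i j = ∑ i : Fin m, ∑ j : Fin m with j ≠ i, f j i := by
  rw [sum_sum_filter_ne_eq, sum_sum_filter_ne_eq (fun i j => f j i), Finset.sum_comm]

/-- `∑ᵢ ∑_{j ≠ i} g i j = 2 ∑ᵢ ∑_{j > i} g i j` for symmetric `g`. [folklore] -/
theorem sum_sum_filter_ne_eq_two_mul {g : Fin m → Fin m → ℝ} (hg : ∀ i j, g i j = g j i) :
    ∑ i : Fin m, ∑ j : Fin m with j ≠ i, g i j = 2 * ∑ i : Fin m, ∑ j : Fin m with i < j, g i j := by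
  have hsplit : ∀ i : Fin m, ∑ j : Fin m with j ≠ i, g i j =
      ∑ j : Fin m with i < j, g i j + ∑ j : Fin m with j < i, g i j := by
    intro i
    rw [← Finset.sum_union]
    · refine Finset.sum_congr ?_ fun _ _ => rfl
      ext j
      simp only [Finset.mem_filter, Finset.mem_univ, true_and, Finset.mem_union]
      rcases lt_trichotomy i j with h | h | h
      · exact ⟨fun _ => Or.inl h, fun _ => ne_of_gt h⟩
      · subst h; simp
      · exact ⟨fun _ => Or.inr h, fun _ => ne_of_lt h⟩
    · rw [Finset.disjoint_filter]
      intro j _ h1 h2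
      exact lt_asymm h1 h2
  simp only [hsplit, Finset.sum_add_distrib]
  have hswap : ∑ i : Fin m, ∑ j : Fin m with j < i, g i j = ∑ i : Fin m, ∑ j : Fin m with i < j, g i j := by
    rw [Finset.sum_comm' (t' := Finset.univ) (s' := fun j => Finset.univ.filter fun i => j < i)]
    · refine Finset.sum_congr rfl fun j _ => Finset.sum_congr rfl fun i _ => hg i j
    · intro i j
      simp only [Finset.mem_univ, Finset.mem_filter, true_and, and_true]
  rw [hswap]
  ring

/-- `|∑_{i∈s} aᵢ|² ≤ |s| ∑_{i∈s} |aᵢ|²` (Cauchy–Schwarz). [folklore] -/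
theorem norm_sum_sq_le (s : Finset (Fin m)) (a : Fin m → ℂ) :
    ‖∑ i ∈ s, a i‖ ^ 2 ≤ s.card * ∑ i ∈ s, ‖a i‖ ^ 2 := by
  calc ‖∑ i ∈ s, a i‖ ^ 2 ≤ (∑ i ∈ s, ‖a i‖) ^ 2 := by
        gcongr
        exact norm_sum_le _ _
    _ = (∑ i ∈ s, 1 * ‖a i‖) ^ 2 := by simp only [one_mul]
    _ ≤ (∑ i ∈ s, (1 : ℝ) ^ 2) * ∑ i ∈ s, ‖a i‖ ^ 2 := Finset.sum_mul_sq_le_sq_mul_sq _ _ _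
    _ = s.card * ∑ i ∈ s, ‖a i‖ ^ 2 := by simp

end Sums

/-! ### Two projections: `PᵢPⱼ` sees neither `xᵢ` nor `xⱼ`; weights against `⟨H, PᵢG⟩` -/

section PairCalculus

/-- `Pᵢ(PⱼF)` does not depend on `xⱼ` either (`i ≠ j`). [cite: Fournais2020, (2.5)] -/
theorem nbodyP_nbodyP_update_right {N : ℕ} (ℓ : ℝ) (u : Space) {i j : Fin N} (hij : i ≠ j)
    (F : Config N → ℂ) (X : Config N) (z : Space) :
    nbodyP ℓ u i (nbodyP ℓ u j F) (Function.update X j z) = nbodyP ℓ u i (nbodyP ℓ u j F) X := by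
  simp only [nbodyP, Function.update_comm hij.symm, Function.update_idem]

/-- The `xⱼ`-marginal of a pair weight, as a real function of `X`, is measurable. [folklore] -/
theorem measurable_toReal_lintegral_pairWeight (j : Fin (n + 1)) {w : Space → Space → ℝ≥0∞}
    (hw : Measurable fun p : Space × Space => w p.1 p.2) :
    Measurable fun X : Config (n + 1) => (∫⁻ y in slidingBox ℓ u, w y (X j)).toReal :=
  (measurable_lintegral_pairWeight j hw).ennreal_toReal

/-- `∫_Λ w(y,x).toReal dy = (∫⁻_Λ w(y,x) dy).toReal` when the marginal is finite. [folklore] -/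
theorem integral_toReal_pairWeight {w : Space → Space → ℝ≥0∞} (hw : Measurable fun p : Space × Space => w p.1 p.2)
    {K : ℝ≥0∞} (hK : K ≠ ⊤) (hKb : ∀ x, ∫⁻ y in slidingBox ℓ u, w y x ≤ K) (x : Space) :
    ∫ y in slidingBox ℓ u, (w y x).toReal = (∫⁻ y in slidingBox ℓ u, w y x).toReal := by
  have hm : AEMeasurable (fun y => w y x) (volume.restrict (slidingBox ℓ u)) :=
    (hw.comp (measurable_id.prodMk measurable_const)).aemeasurable
  exact integral_toReal hm (ae_lt_top' hm (ne_top_of_le_ne_top hK (hKb x)))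

/-- **Integrating out `xᵢ` under a pair weight and removing `Pᵢ`**: for `H` not depending on
`xᵢ` and `G` in `L²(Λⁿ⁺¹)`,
`∫ w(xᵢ,xⱼ) conj(H) PᵢG dX = ℓ⁻³ ∫ (∫_Λ w(y,xⱼ)dy) conj(H) G dX`
("`PᵢF(xᵢ,y)Pᵢ = ℓ⁻³Pᵢ∫F(x,y)dx`" and `Pᵢ² = Pᵢ = Pᵢ*`). [cite: Fournais2020, remark preceding Lemma 2.3, (2.5)] -/
theorem integral_pairWeight_conj_mul_nbodyP (hℓ : 0 < ℓ) {i j : Fin (n + 1)} (hij : i ≠ j)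
    {w : Space → Space → ℝ≥0∞} (hw : Measurable fun p : Space × Space => w p.1 p.2) {K : ℝ≥0∞} (hK : K ≠ ⊤)
    (hKb : ∀ x, ∫⁻ y in slidingBox ℓ u, w y x ≤ K)
    {H G : Config (n + 1) → ℂ} (hHm : Measurable H) (hH : ∀ X y, H (Function.update X i y) = H X)
    (hH2 : MemLp H 2 (volume.restrict (boxConfig (n + 1) ℓ u))) (hGm : Measurable G)
    (hG2 : MemLp G 2 (volume.restrict (boxConfig (n + 1) ℓ u))) :
    ∫ X in boxConfig (n + 1) ℓ u, ((w (X i) (X j)).toReal : ℂ) * (conj (H X) * nbodyP ℓ u i G X) =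
      ((ℓ ^ 3)⁻¹ : ℝ) • ∫ X in boxConfig (n + 1) ℓ u,
        ((∫⁻ y in slidingBox ℓ u, w y (X j)).toReal : ℂ) * (conj (H X) * G X) := by
  have hℓ3 : ENNReal.ofReal ℓ ^ 3 ≠ 0 := pow_ne_zero _ (by rwa [Ne, ENNReal.ofReal_eq_zero, not_le])
  have hPG := memLp_nbodyP hℓ i hGm hG2
  have hPGm := measurable_nbodyP ℓ u i hGm
  have hwij : AEMeasurable (fun X : Config (n + 1) => w (X i) (X j))
      (volume.restrict (boxConfig (n + 1) ℓ u)) := by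
    have h1 : Measurable fun X : Config (n + 1) => (X i, X j) :=
      (measurable_pi_apply i).prodMk (measurable_pi_apply j)
    exact (hw.comp h1).aemeasurable
  -- finiteness of the weighted norms of `H` and `PᵢG` (both independent of `xᵢ`)
  have hfin : ∀ {F : Config (n + 1) → ℂ}, Measurable F → (∀ X y, F (Function.update X i y) = F X) →
      MemLp F 2 (volume.restrict (boxConfig (n + 1) ℓ u)) →
      ∫⁻ X in boxConfig (n + 1) ℓ u, w (X i) (X j) * (‖F X‖₊ : ℝ≥0∞) ^ 2 ≠ ⊤ := by
    intro F hFm hF hF2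
    refine ne_top_of_le_ne_top ?_ (lintegral_pairWeight_mul_le hℓ hij hw hKb
      (hFm.nnnorm.coe_nnreal_ennreal.pow_const _) (fun X y => by rw [hF]))
    exact ENNReal.mul_ne_top (ENNReal.mul_ne_top (ENNReal.inv_ne_top.mpr hℓ3) hK)
      (lintegral_ne_top_of_memLp_two hF2)
  have hKint : Integrable (fun X => ((w (X i) (X j)).toReal : ℂ) * (conj (H X) * nbodyP ℓ u i G X))
      (volume.restrict (boxConfig (n + 1) ℓ u)) :=
    integrable_toReal_mul_conj_mul hwij hHm.aestronglyMeasurable hPGm.aestronglyMeasurable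
      (hfin hHm hH hH2) (hfin hPGm (fun X y => nbodyP_update ℓ u i G X y) hPG)
  -- `∫ K = ∫ PᵢK`
  rw [← integral_nbodyP hℓ i hKint]
  -- `PᵢK = ℓ⁻³ (∫_Λ w(y,xⱼ)dy) conj(H) PᵢG`
  have hPK : ∀ X, nbodyP ℓ u i (fun X => ((w (X i) (X j)).toReal : ℂ) * (conj (H X) * nbodyP ℓ u i G X)) X =
      ((ℓ ^ 3)⁻¹ : ℝ) • (((∫⁻ y in slidingBox ℓ u, w y (X j)).toReal : ℂ) *
        (conj (H X) * nbodyP ℓ u i G X)) := by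
    intro X
    unfold nbodyP
    simp only [Function.update_self, Function.update_of_ne hij.symm, hH, Function.update_idem]
    rw [integral_mul_const, integral_complex_ofReal, integral_toReal_pairWeight hw hK hKb]
  simp only [hPK]
  rw [integral_smul]
  congr 1
  -- remove `Pᵢ` against the `xᵢ`-independent `(∫_Λ w(y,xⱼ)dy) H`
  have hU := measurable_toReal_lintegral_pairWeight (ℓ := ℓ) (u := u) j hw
  have h1 : ∀ X F, ((∫⁻ y in slidingBox ℓ u, w y (X j)).toReal : ℂ) * (conj (H X) * F) =
      conj (((∫⁻ y in slidingBox ℓ u, w y (X j)).toReal : ℂ) * H X) * F := fun X F => by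
    rw [map_mul, Complex.conj_ofReal, mul_assoc]
  simp only [h1]
  refine integral_conj_mul_nbodyP hℓ i (H := fun X => ((∫⁻ y in slidingBox ℓ u, w y (X j)).toReal : ℂ) * H X)
    (fun X y => by simp only [Function.update_of_ne hij.symm, hH]) ?_
  -- integrability of `conj((∫w) H) G`: bounded times `L¹`
  have h2 : ∀ X, conj (((∫⁻ y in slidingBox ℓ u, w y (X j)).toReal : ℂ) * H X) * G X =
      ((∫⁻ y in slidingBox ℓ u, w y (X j)).toReal : ℂ) * (conj (H X) * G X) := fun X => by
    rw [h1]
  simp only [h2]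
  refine (integrable_conj_mul hH2 hG2).bdd_mul (c := K.toReal)
    ((Complex.continuous_ofReal.comp_aestronglyMeasurable hU.aestronglyMeasurable)) ?_
  refine Filter.Eventually.of_forall fun X => ?_
  rw [Complex.norm_real, Real.norm_of_nonneg ENNReal.toReal_nonneg]
  exact ENNReal.toReal_mono hK (hKb _)

/-- **Integrability of `w(xᵢ,xⱼ) conj(H) G'`** for `H, G' ∈ L²` not depending on `xᵢ`.
[cite: Fournais2020, remark preceding Lemma 2.3] -/
theorem integrable_pairWeight_conj_mul (hℓ : 0 < ℓ) {i j : Fin (n + 1)} (hij : i ≠ j)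
    {w : Space → Space → ℝ≥0∞} (hw : Measurable fun p : Space × Space => w p.1 p.2) {K : ℝ≥0∞}
    (hK : K ≠ ⊤) (hKb : ∀ x, ∫⁻ y in slidingBox ℓ u, w y x ≤ K)
    {H G' : Config (n + 1) → ℂ} (hHm : Measurable H) (hH : ∀ X y, H (Function.update X i y) = H X)
    (hH2 : MemLp H 2 (volume.restrict (boxConfig (n + 1) ℓ u))) (hGm : Measurable G')
    (hG : ∀ X y, G' (Function.update X i y) = G' X)
    (hG2 : MemLp G' 2 (volume.restrict (boxConfig (n + 1) ℓ u))) :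
    Integrable (fun X => ((w (X i) (X j)).toReal : ℂ) * (conj (H X) * G' X))
      (volume.restrict (boxConfig (n + 1) ℓ u)) := by
  have hℓ3 : ENNReal.ofReal ℓ ^ 3 ≠ 0 := pow_ne_zero _ (by rwa [Ne, ENNReal.ofReal_eq_zero, not_le])
  have h1 : Measurable fun X : Config (n + 1) => (X i, X j) :=
    (measurable_pi_apply i).prodMk (measurable_pi_apply j)
  have hwij : AEMeasurable (fun X : Config (n + 1) => w (X i) (X j))
      (volume.restrict (boxConfig (n + 1) ℓ u)) := (hw.comp h1).aemeasurable
  have hfin : ∀ {F : Config (n + 1) → ℂ}, Measurable F → (∀ X y, F (Function.update X i y) = F X) →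
      MemLp F 2 (volume.restrict (boxConfig (n + 1) ℓ u)) →
      ∫⁻ X in boxConfig (n + 1) ℓ u, w (X i) (X j) * (‖F X‖₊ : ℝ≥0∞) ^ 2 ≠ ⊤ := by
    intro F hFm hF hF2
    refine ne_top_of_le_ne_top ?_ (lintegral_pairWeight_mul_le hℓ hij hw hKb
      (hFm.nnnorm.coe_nnreal_ennreal.pow_const _) (fun X y => by rw [hF]))
    exact ENNReal.mul_ne_top (ENNReal.mul_ne_top (ENNReal.inv_ne_top.mpr hℓ3) hK)
      (lintegral_ne_top_of_memLp_two hF2)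
  exact integrable_toReal_mul_conj_mul hwij hHm.aestronglyMeasurable hGm.aestronglyMeasurable
    (hfin hHm hH hH2) (hfin hGm hG hG2)

/-- **Integrability of `(∫_Λ w(y,xⱼ)dy) conj(H) G`** for `H, G ∈ L²` (bounded marginal).
[cite: Fournais2020, remark preceding Lemma 2.3] -/
theorem integrable_marginal_conj_mul (j : Fin (n + 1))
    {w : Space → Space → ℝ≥0∞} (hw : Measurable fun p : Space × Space => w p.1 p.2) {K : ℝ≥0∞}
    (hK : K ≠ ⊤) (hKb : ∀ x, ∫⁻ y in slidingBox ℓ u, w y x ≤ K)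
    {H G : Config (n + 1) → ℂ} (hH2 : MemLp H 2 (volume.restrict (boxConfig (n + 1) ℓ u)))
    (hG2 : MemLp G 2 (volume.restrict (boxConfig (n + 1) ℓ u))) :
    Integrable (fun X => ((∫⁻ y in slidingBox ℓ u, w y (X j)).toReal : ℂ) * (conj (H X) * G X))
      (volume.restrict (boxConfig (n + 1) ℓ u)) := by
  have hU := measurable_toReal_lintegral_pairWeight (ℓ := ℓ) (u := u) j hw
  refine (integrable_conj_mul hH2 hG2).bdd_mul (c := K.toReal)
    ((Complex.continuous_ofReal.comp_aestronglyMeasurable hU.aestronglyMeasurable)) ?_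
  refine Filter.Eventually.of_forall fun X => ?_
  rw [Complex.norm_real, Real.norm_of_nonneg ENNReal.toReal_nonneg]
  exact ENNReal.toReal_mono hK (hKb _)

/-- **Real form of `∫ w(xᵢ,xⱼ) conj(H) PᵢG = ℓ⁻³ ∫ (∫_Λ w(y,xⱼ)dy) conj(H) G`.**
[cite: Fournais2020, remark preceding Lemma 2.3, (2.5)] -/
theorem integral_pairWeight_re_conj_mul_nbodyP (hℓ : 0 < ℓ) {i j : Fin (n + 1)} (hij : i ≠ j)
    {w : Space → Space → ℝ≥0∞} (hw : Measurable fun p : Space × Space => w p.1 p.2) {K : ℝ≥0∞}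
    (hK : K ≠ ⊤) (hKb : ∀ x, ∫⁻ y in slidingBox ℓ u, w y x ≤ K)
    {H G : Config (n + 1) → ℂ} (hHm : Measurable H) (hH : ∀ X y, H (Function.update X i y) = H X)
    (hH2 : MemLp H 2 (volume.restrict (boxConfig (n + 1) ℓ u))) (hGm : Measurable G)
    (hG2 : MemLp G 2 (volume.restrict (boxConfig (n + 1) ℓ u))) :
    ∫ X in boxConfig (n + 1) ℓ u, (w (X i) (X j)).toReal * (conj (H X) * nbodyP ℓ u i G X).re =
      (ℓ ^ 3)⁻¹ * ∫ X in boxConfig (n + 1) ℓ u,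
        (∫⁻ y in slidingBox ℓ u, w y (X j)).toReal * (conj (H X) * G X).re := by
  have hc := integral_pairWeight_conj_mul_nbodyP hℓ hij hw hK hKb hHm hH hH2 hGm hG2
  have hI1 := integrable_pairWeight_conj_mul hℓ hij hw hK hKb hHm hH hH2 (measurable_nbodyP ℓ u i hGm)
    (fun X y => nbodyP_update ℓ u i G X y) (memLp_nbodyP hℓ i hGm hG2)
  have hI2 := integrable_marginal_conj_mul j hw hK hKb hH2 hG2
  have h1 := integral_re hI1
  have h2 := integral_re hI2
  simp only [RCLike.re_to_complex, Complex.re_ofReal_mul] at h1 h2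
  rw [h1, h2, hc, Complex.real_smul, Complex.re_ofReal_mul]

end PairCalculus

end Literature.MathematicalPhysics.QuantumManyBody.BoseGas

end
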